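/-
Copyright: b2b-lace packet (CARVER gen 57).  [FvdH17] Lemma 5.1, weighted display (lemmapercboundXi1-2) and its proof in
§6.1 ((lemmapercboundXi1-1-step0.1)–(step0.3), (XiIota-Deltabounds-versions1)): the BOOKKEEPING of the `u⃗`-extraction —
from three event-level class estimates to VERSION 1, and to VERSION 2 in RAW form (the one-side-trivial
configurations carried as two explicit sums, App. C.1 of the extended version) — in abstract letters.  Proofs only;
no named fact; no numeral; no dimension.
-/
import Literature.Probability.FitznerVanDerHofstad2017.NobleBoundsN1Classes
import Literature.Probability.FitznerVanDerHofstad2017.NobleWeightedBlocks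
import Literature.Probability.FitznerVanDerHofstad2017.BlockSummationAvg
import HarnessLib

/-!
# [FvdH17] Lemma 5.1, (lemmapercboundXi1-2): `Σ_x ‖x‖₂² Ξ^{(1)}_p(x) ≤` VERSION 1 ∕ VERSION 2 (raw) — the assembly from three class estimates

CITATION HEADER (PLACEMENT v2). This module is part of a certified REPRODUCTION of:
R. Fitzner, R. van der Hofstad, *Mean-field behavior for nearest-neighbor percolation in `d > 10`*, Electron. J.
Probab. **22** (2017) no. 43 [FvdH17] (arXiv:1506.07977v2), Lemma 5.1 "Bounds on `Ξ^{(1)}_p` and `Ψ^{(1),κ}_p`"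
(v2 p. 50; TeX source of the extended version `Bounds/BoundNOne.tex` l.19–30), display (lemmapercboundXi1-2)
`Σ_x ‖x‖₂² Ξ^{(1)}_p(x) ≤ β^{(1)}_{ΔΞ}`, and its PROOF in §6.1 (v2 pp. 59–60; `Bounds/BoundsProof.tex` l.128–183):
"we define `Q^{S,0}(x,y) = Q^{E,0}(x,y) = P^{S,0}(x,y)`, `Q^{S,1}(x,y) = 2dD(x−y)(δ_{0,y}τ_{3,p}(x) + B_{1,1}(−y,x−y))`,
`Q^{S,2}(x,y) = δ_{0,y}τ_{2,p}(x) + B_{1,1}(−y,x−y)` and `Q^{E,b}(x,y) = (1−δ_{0,y})Q^{S,b}(x,y)` for `b = 1,2`.  Then, we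
show that, next to the bound in (step0), also the bounds (step0.1) `Ξ^{(1)}_p(x) ≤ Σ_{a,b} Σ_{u,ι,w,z,t} P^{S,a}(u,w)
A^{ι,a,b}(u,w,t,z) Q^{E,b}(t−x,z−x)`, (step0.2) `Ξ^{(1)}_p(x) ≤ Σ_{a,b} Σ_{u,ι,w,z,t} Q^{S,a}(u,w) A^{ι,b,a}(t,z,u,w)
P^{E,b}(t−x,z−x)` hold. […] For our bound we split the weight `‖x‖₂²` using the inequality `‖x‖₂² ≤ 3(‖w‖₂² +
‖z−w‖₂² + ‖x−z‖₂²)`.  More precisely, we first use this inequality for each given configuration and then apply the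
bounds (step0), (step0.1), (step0.2) to obtain (step0.3) […].  We obtain the bound (lemmapercboundXi1-2) by extracting
the special case that one or both of the triangles on the left and right are trivial, characterized by `u⃗ᵀ = (1,0,0)`.
In this case we simply use the weight `‖x‖₂²` or apply the inequalities `‖x‖₂² ≤ 2(‖w‖₂² + ‖x−w‖₂²)` if `z = x`, or
`‖x‖₂² ≤ 2(‖z‖₂² + ‖x−z‖₂²)` if `w = 0`.  In this way we obtain the bound (XiIota-Deltabounds-versions1)
`Σ_x ‖x‖₂² Ξ^{(1)}_p(x) ≤ u⃗ᵀH⁽³⁾u⃗ + 2u⃗ᵀH⁽³⁾(P⃗^E − u⃗) + 2u⃗ᵀA^ι h⃗^E + 2h⃗^S A^ι u⃗ + 2(P⃗^S − u⃗ᵀ)H⁽³⁾u⃗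
+ 3h⃗^S A^ι (P⃗^E − u⃗) + 3(P⃗^S − u⃗ᵀ)H⁽³⁾(P⃗^E − u⃗) + 3(P⃗^S − u⃗ᵀ)A^ι h⃗^E`."  (The STATEMENT of Lemma 5.1,
`BoundNOne.tex` l.29, prints the first-term matrix transposed, `3 h⃗^S (A^ι)ᵀ (P⃗^E − u⃗)`, as forced by the index
order `A^{ι,b,a}(t,z,u,w)` of (step0.2); so does the notebook `Percolation.nb` (`Transpose[Matrix[Aiota,s]]`,
transcript l.716).  This module carries the transpose.)  Origin: build `lace` (host summit CriticalPhenomena), CARVER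
seat; node N76-XI1DELTA, children W01 (the three class estimates, event level) and W2 + glue (THIS module).

Packet cross-references (b2b-lace): ASSUMPTION A-W01 = the two hypothesis families `h01`/`h02` of the companion
x-space module `NobleWeightedN1XSpace` (nothing internally minted is cited); DIVERGENCE D93 = the transpose remark
above (`(A^ι)ᵀ` in the first `3`-term); DIVERGENCE D96 = the row-`(0,0)` letter read from §6.1 (primed families).

WHAT THIS FILE DOES (all `d`-generic, every letter family a PARAMETER, nothing about percolation events is proved
here).  It is the weighted twin of `NobleBoundsN1Classes.nobleXiT_one_le_blocks_of_cls` (bookkeeping half of (6.4))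
followed by the weighted twin of `NobleBoundsN1Summation` ((6.4) ⇒ (6.5)):
* A. the weight splits `‖a+b‖₂² ≤ 2(‖a‖₂² + ‖b‖₂²)`, `‖a+b+c‖₂² ≤ 3(‖a‖₂² + ‖b‖₂² + ‖c‖₂²)` in `[0,∞]` (`wt`);
* B. the TRIVIAL PIECE `blockTriv a x y = 𝟙{a = 0} δ_{0,x} δ_{0,y}` (the `u⃗ = (1,0,0)` of the print: `vecP blockTriv
  = (1,0,0)`), the percolation letters minus their trivial piece `blockPSn`/`blockPEn` (`P^{S} = triv + P^{S}_n`,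
  `P^{E} = triv + P^{E}_n` pointwise: `(P⃗^S − u⃗)`, `(P⃗^E − u⃗)` without truncated subtraction), and the weighted
  families `wtMid A` (`‖v−y‖₂² A^{ι,a,b}(u,v,x,y)`, the `H^{(3)}` pattern: `wtMid (blockAbarSt L) = blockH3 L`),
  `wtSnd Q` (`‖y‖₂² Q^b(x,y)`, the `h⃗^S`/`h⃗^E` pattern) and `revT A` (`A^{ι,b,a}(t,z,u,w)`);
* C. POINTWISE: if a quantity `X` (think `J(v−u)·ℙ^{⊗2}(E(u,v,w,z,t) ∩ class(a,b))`) obeys the three estimates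
  `X ≤ Σ_ι c_ι P^{S,a}(u,w) Ā^{ι,a,b}(u,w,t,z) P^{E,b}(t−x,z−x)` (step0), `… P^{S,a} A^{ι,a,b} Q^{E,b}` (step0.1),
  `… Q^{S,a}(u,w) A^{ι,b,a}(t,z,u,w) P^{E,b}` (step0.2), then `‖x‖₂² X ≤ Σ_ι c_ι V₁(x;ι,a,b,u,w,t,z)` where `V₁` is
  the eight-term integrand of (versions1) (`v1Integrand`) — by the case distinction `w = 0?`, `z = x?` and the three
  weight splits, exactly as printed ("for each given configuration");
* D. `x`-SPACE: the class-split version over the two-level percolation space (event family `E`, classes `clsSet`),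
  concluding `‖x‖₂² Ξ(x) ≤ Σ_{u,w,t,z} Σ_{ι,a,b} V₁(x;…)` — the hypothesis of E;
* E. SUMMATION: the split (6.5) in three shapes gives
  `Σ_x ‖x‖₂² Ξ(x) ≤ versionOne u⃗ (P⃗^S−u⃗) (P⃗^E−u⃗) h⃗^S h⃗^E H A Aᵀ` with `u⃗ = vecP blockTriv`, `(P⃗−u⃗) = vecP P_n`
  (full pair sums), `h⃗^S = vecH (wtSnd Q^S)`, `h⃗^E = vecH (wtSnd Q^E)` (SUP-GAP functionals `sup_y Σ_s ‖s+y‖₂² Q(s,s+y)`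
  — the shape of the row-`0` entries of `H^{(1)}`, `H^{(3)}`; the full pair sum of a weighted flank is not a finite
  tabulated object), `H = matAbar (wtMid Ā)` (DOUBLE-OPEN norm, four `H`-terms: `BlockSummation.tsum_le_of_xSpaceBound'`),
  `A = matB A^ι` (the printed CLOSED norm `({\bf A}^ι)_{a,b} = sup_v Σ_{ι,x,y} A^{ι,a,b}(0,v,x,y)`; terms `u⃗ A h⃗^E`,
  `(P⃗^S−u⃗) A h⃗^E`: `blkTsum_le_vecP_matB_vecH`) and `Aᵀ = (matB A^ι)ᵀ` (terms `h⃗^S Aᵀ u⃗`, `h⃗^S Aᵀ (P⃗^E−u⃗)`, block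
  entered from its exit pair: `blkTsum_revT_le_vecH_matBT_vecP`);
* E′. the same with the AVERAGED element for the `Ā`-terms (`BlockSummationAvg.matAbarAvg U avg (wtMid Ā)`: the
  classes selected by `avg` — class `1̲`, "u and w are neighbors" — have their in-∕out-gaps averaged over `U` = the
  unit vectors), under the support ∕ flank-constancy hypotheses of `BlockSummationAvg.tsum_le_of_xSpaceBound_avg'`
  (`tsum_wt_mul_le_versionOne_avg`); the `A^ι`-terms keep the closed supremum norm `matB`.
* C″/D″/E‴. VERSION 2 in RAW form: the same extraction keeping the configurations with EXACTLY ONE trivial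
  triangle UNSPLIT (`v2Integrand`; both-trivial ⇒ `‖x‖₂² = ‖w−z‖₂²` on `Ā`, none ⇒ the factor-`3` split), summed to
  `versionTwoRaw … (rawR P^S_n Ā) (rawL Ā P^E_n) = u⃗Hu⃗ + R_R + R_L + 3h⃗^S Aᵀ(P⃗^E−u⃗) + 3(P⃗^S−u⃗)H(P⃗^E−u⃗)
  + 3(P⃗^S−u⃗)A h⃗^E` (`tsum_wt_mul_le_versionTwoRaw_avg`).  The printed SECOND VERSION of Lemma 5.1
  (`BoundNOne.tex` l.19–30: `u⃗H⁽³⁾u⃗ + Σ_{n=1}^{3}(2H⁽³⁾_{n,0} + …) + (P⃗^S−u⃗ᵀ)_2 (…) + (P⃗^S−u⃗ᵀ)_3 (…) + 3(…)`)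
  is this with `R_R + R_L` bounded by the eight diagrammatic terms of App. C.1 "Improvement of a bound on Ξ^{(1)}"
  of the extended version (TeX `AdditionalBoundForLongVersion.tex` l.9–70: cases a)–d) for the right-trivial sum,
  the mirror argument for the left-trivial one) — NOT done in this module; `rawR_eq` ∕ `rawL_eq` collapse the two
  raw sums to the App.-C.1 diagrams `Σ ‖x‖₂² P^{S,a}_n(u,w) Ā^{ι,a,0}(u,w,x,x)` and
  `Σ ‖x‖₂² Ā^{ι,0,b}(0,0,t,z) P^{E,b}_n(t−x,z−x)`, the entry points of those bounds; the pieces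
  `rawRPiece Sn Ā ι a` ∕ `rawLPiece Ā En ι b` (`rawR_eq_sum_rawRPiece`, `rawL_eq_sum_rawLPiece`), the split of a
  right piece at `w = 0` (`rawRPiece_eq_at0_add_off0`: Case b) vs Cases c), d)), and for class `0` the CONVOLUTION
  SHAPE of Case a) (`rawRPiece_zero_eq_of_kd`, `rawLPiece_zero_eq_of_kd`; for the NoBLE letters
  `rawRPiece_blockPSn_zero_eq`: `R_R(ι,0) = Σ_w Σ_x ‖x‖₂² (1−δ_{0,w})P(0⇔w) Ā^{ι,0,0}(0,0,x−w,x−w)`, and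
  `rawLPiece_blockPEn_zero_eq`) — the left side of the orthogonal split `‖x‖₂² = ‖w‖₂² + ‖x−w‖₂² + 2⟨w,x−w⟩` of
  (C.2), whose cross term dies on the evenness of the double connection (that step is not taken here);
* G. monotonicity of `normOO`, `normOOavg`, `matAbarAvg` entries and `wtMid` in the block (for the identification
  of the `H`-matrix over `Ā'` with the tabulated one over `Ā'^*`, `NobleWeightedN1XSpace` Part F).
READINGS.  (R1) The identification of `h⃗^S`, `h⃗^E`, `H^{(3)}` with the §5.1 objects `(H^{(1)})_{0,b}`, `(H^{(3)})_{0,b}`,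
`(H^{(3)})_{a,b}` ("We have defined the diagrams in `h⃗^S`, `h⃗^E` and `H^{(3)}` as the bound on the weighted version
of `Q^S`, `Q^E` and `Ā^ι`", `BoundsProof.tex` l.163) is NOT made here: the conclusion is stated over the honest
weighted sums of whatever letters the event-level estimates deliver.  (R2) The case distinction is on the DATA `w = 0`,
`z = x` of a configuration (the print's "if `z = x`", "if `w = 0`"); the resulting integrand is then COARSENED to the
eight terms of (versions1) using `P^S = triv + P^S_n`, `P^E = triv + P^E_n` (a configuration with `w = 0` but a
non-trivial left triangle is charged the factor `3` of (versions1) although `2` would do).  Nothing landed is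
modified; no cited hypothesis — every statement is a definition or a kernel-proved lemma.
-/

noncomputable section

namespace Literature.Probability.FitznerVanDerHofstad2017

open _root_.MeasureTheory Finset
open scoped BigOperators ENNReal Matrix
open Literature.Probability.LatticeModels Literature.Probability.Percolation
open Literature.Barriers.CriticalPhenomena
open Literature.Probability.FitznerVanDerHofstad2017.BlockSummation
open Literature.Probability.FitznerVanDerHofstad2017.NobleBlocks

variable {d : ℕ}

namespace NobleBlocks

/-! ## A. Weight splits in `[0,∞]` -/

/-- `‖x‖₂² = Σ_i x_i²` for the Euclidean norm of `LaceExpansionXSpaceAsymptotics`. [folklore] -/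
private theorem euclidNorm_sq_eq_sum (x : Site d) : euclidNorm x ^ 2 = ∑ i, ((x i : ℤ) : ℝ) ^ 2 :=
  Real.sq_sqrt (Finset.sum_nonneg fun _ _ => sq_nonneg _)

/-- `‖a+b‖₂² ≤ 2(‖a‖₂² + ‖b‖₂²)`. [cite: FitznerVanDerHofstad2017, §6.1 proof of Lemma 5.1, display after (XiIota-Deltabounds-versions0) (arXiv:1506.07977v2 p. 60)] -/
theorem euclidNorm_sq_add_le_two (a b : Site d) :
    euclidNorm (a + b) ^ 2 ≤ 2 * (euclidNorm a ^ 2 + euclidNorm b ^ 2) := by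
  simp only [euclidNorm_sq_eq_sum, Pi.add_apply, Int.cast_add, mul_add, Finset.mul_sum, ← Finset.sum_add_distrib]
  exact Finset.sum_le_sum fun j _ => by nlinarith [sq_nonneg (((a j : ℤ) : ℝ) - ((b j : ℤ) : ℝ))]

/-- `‖a+b+c‖₂² ≤ 3(‖a‖₂² + ‖b‖₂² + ‖c‖₂²)`. [cite: FitznerVanDerHofstad2017, §6.1 proof of Lemma 5.1, display before (lemmapercboundXi1-1-step0.3) (arXiv:1506.07977v2 p. 59)] -/
theorem euclidNorm_sq_add_add_le_three (a b c : Site d) :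
    euclidNorm (a + b + c) ^ 2 ≤ 3 * (euclidNorm a ^ 2 + euclidNorm b ^ 2 + euclidNorm c ^ 2) := by
  simp only [euclidNorm_sq_eq_sum, Pi.add_apply, Int.cast_add, mul_add, Finset.mul_sum, ← Finset.sum_add_distrib]
  exact Finset.sum_le_sum fun j _ => by
    nlinarith [sq_nonneg (((a j : ℤ) : ℝ) - ((b j : ℤ) : ℝ)), sq_nonneg (((b j : ℤ) : ℝ) - ((c j : ℤ) : ℝ)),
      sq_nonneg (((a j : ℤ) : ℝ) - ((c j : ℤ) : ℝ))]

/-- `‖a+b‖₂² ≤ 2(‖a‖₂² + ‖b‖₂²)` for the weight `wt`. [cite: FitznerVanDerHofstad2017, §6.1 proof of Lemma 5.1 (arXiv:1506.07977v2 p. 60)] -/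
theorem wt_add_le_two (a b : Site d) : wt (a + b) ≤ 2 * (wt a + wt b) := by
  unfold wt
  calc ENNReal.ofReal (euclidNorm (a + b) ^ 2)
      ≤ ENNReal.ofReal (2 * (euclidNorm a ^ 2 + euclidNorm b ^ 2)) :=
        ENNReal.ofReal_le_ofReal (euclidNorm_sq_add_le_two a b)
    _ = 2 * (ENNReal.ofReal (euclidNorm a ^ 2) + ENNReal.ofReal (euclidNorm b ^ 2)) := by
        rw [ENNReal.ofReal_mul (by norm_num), ENNReal.ofReal_add (sq_nonneg _) (sq_nonneg _), ENNReal.ofReal_ofNat]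

/-- `‖a+b+c‖₂² ≤ 3(‖a‖₂² + ‖b‖₂² + ‖c‖₂²)` for the weight `wt`. [cite: FitznerVanDerHofstad2017, §6.1 proof of Lemma 5.1 (arXiv:1506.07977v2 p. 59)] -/
theorem wt_add_add_le_three (a b c : Site d) : wt (a + b + c) ≤ 3 * (wt a + wt b + wt c) := by
  unfold wt
  calc ENNReal.ofReal (euclidNorm (a + b + c) ^ 2)
      ≤ ENNReal.ofReal (3 * (euclidNorm a ^ 2 + euclidNorm b ^ 2 + euclidNorm c ^ 2)) :=
        ENNReal.ofReal_le_ofReal (euclidNorm_sq_add_add_le_three a b c)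
    _ = 3 * (ENNReal.ofReal (euclidNorm a ^ 2) + ENNReal.ofReal (euclidNorm b ^ 2)
          + ENNReal.ofReal (euclidNorm c ^ 2)) := by
        rw [ENNReal.ofReal_mul (by norm_num), ENNReal.ofReal_add (by positivity) (sq_nonneg _),
          ENNReal.ofReal_add (sq_nonneg _) (sq_nonneg _), ENNReal.ofReal_ofNat]

/-- The split of the print, "`‖x‖₂² ≤ 3(‖w‖₂² + ‖z−w‖₂² + ‖x−z‖₂²)`", in the argument order of the blocks
(`‖w−z‖`, `‖z−x‖`). [cite: FitznerVanDerHofstad2017, §6.1 proof of Lemma 5.1, display before (lemmapercboundXi1-1-step0.3) (arXiv:1506.07977v2 p. 59)] -/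
theorem wt_le_three_split (x w z : Site d) : wt x ≤ 3 * (wt w + wt (w - z) + wt (z - x)) := by
  have h := wt_add_add_le_three w (z - w) (x - z)
  rw [show w + (z - w) + (x - z) = x by abel, wt_sub_comm z w, wt_sub_comm x z] at h
  exact h

/-- "`‖x‖₂² ≤ 2(‖w‖₂² + ‖x−w‖₂²)` if `z = x`". [cite: FitznerVanDerHofstad2017, §6.1 proof of Lemma 5.1, display after (XiIota-Deltabounds-versions0) (arXiv:1506.07977v2 p. 60)] -/
theorem wt_le_two_split_left (x w : Site d) : wt x ≤ 2 * (wt w + wt (w - x)) := by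
  have h := wt_add_le_two w (x - w)
  rw [show w + (x - w) = x by abel, wt_sub_comm x w] at h
  exact h

/-- "`‖x‖₂² ≤ 2(‖z‖₂² + ‖x−z‖₂²)` if `w = 0`" (with `‖z‖ = ‖0 − z‖`). [cite: FitznerVanDerHofstad2017, §6.1 proof of Lemma 5.1, display after (XiIota-Deltabounds-versions0) (arXiv:1506.07977v2 p. 60)] -/
theorem wt_le_two_split_right (x z : Site d) : wt x ≤ 2 * (wt (0 - z) + wt (z - x)) := by
  have h := wt_add_le_two z (x - z)
  rw [show z + (x - z) = x by abel, wt_sub_comm x z] at h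
  rwa [zero_sub, wt_neg]

/-! ## B. The trivial piece `u⃗`, the letters minus their trivial piece, the weighted families -/

/-- **The trivial triangle**: `𝟙{a = 0} δ_{0,x} δ_{0,y}` — the piece of `P^{S,0}(x,y) = δ_{x,y} P(0 ⇔ x)` at `x = 0`
("one or both of the triangles on the left and right are trivial, characterized by `u⃗ᵀ = (1,0,0)`").
[cite: FitznerVanDerHofstad2017, §6.1 proof of Lemma 5.1, sentence before (XiIota-Deltabounds-versions1) (arXiv:1506.07977v2 p. 60)] -/
def blockTriv (a : Fin 3) (x y : Site d) : ℝ≥0∞ := if a = 0 ∧ x = 0 ∧ y = 0 then 1 else 0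

/-- Off `y = 0` the trivial piece vanishes. (evaluation of the Kronecker deltas of the trivial piece). [cite: FitznerVanDerHofstad2017, §6.1 proof of Lemma 5.1, sentence before (XiIota-Deltabounds-versions1) — the trivial triangle `u⃗ᵀ = (1,0,0)` split off `P^{S,0}`/`P^{E,0}` (arXiv:1506.07977v2 p. 60)] -/
theorem blockTriv_of_ne {a : Fin 3} {x y : Site d} (h : y ≠ 0) : blockTriv a x y = 0 := by
  simp [blockTriv, h]

/-- `blockTriv ≤ 1`. (evaluation of the Kronecker deltas of the trivial piece). [cite: FitznerVanDerHofstad2017, §6.1 proof of Lemma 5.1, sentence before (XiIota-Deltabounds-versions1) — the trivial triangle `u⃗ᵀ = (1,0,0)` split off `P^{S,0}`/`P^{E,0}` (arXiv:1506.07977v2 p. 60)] -/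
theorem blockTriv_le_one (a : Fin 3) (x y : Site d) : blockTriv a x y ≤ 1 := by
  unfold blockTriv; split_ifs <;> simp

/-- **`u⃗ = (1,0,0)`**: `vecP blockTriv a = 𝟙{a = 0}`. [cite: FitznerVanDerHofstad2017, §6.1 proof of Lemma 5.1, "characterized by u⃗ᵀ = (1,0,0)" (arXiv:1506.07977v2 p. 60)] -/
theorem vecP_blockTriv (a : Fin 3) : vecP (blockTriv (d := d)) a = if a = 0 then 1 else 0 := by
  unfold vecP pairSum
  by_cases ha : a = 0
  · rw [if_pos ha, tsum_eq_single (0 : Site d) (fun x hx => by simp [blockTriv, hx])]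
    rw [tsum_eq_single (0 : Site d) (fun y hy => by simp [blockTriv, hy])]
    simp [blockTriv, ha]
  · rw [if_neg ha]
    simp [blockTriv, ha]

/-- **`P^{S,a} − trivial piece`**: in class `0` the non-trivial double connection `δ_{x,y}(1−δ_{0,x})P(0 ⇔ x)`,
classes `1, 2` unchanged (`P⃗^S − u⃗` of (versions1), letter by letter). [cite: FitznerVanDerHofstad2017, App. B Table "definition of P^b(x,y)" rows b = 0 (arXiv:1506.07977v2 p. 73); §6.1 (XiIota-Deltabounds-versions1) (p. 60)] -/
def blockPSn (L : Letters d) (a : Fin 3) (x y : Site d) : ℝ≥0∞ :=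
  if a = 0 then kd x y * (kdc x 0 * L.dbc x) else blockPS L a x y

/-- **`P^{E,b} − trivial piece`** (`P^{E,0} = P^{S,0}`). [cite: FitznerVanDerHofstad2017, §5.1 Table "P^{E,b}" (arXiv:1506.07977v2 p. 47); §6.1 (XiIota-Deltabounds-versions1) (p. 60)] -/
def blockPEn (L : Letters d) (b : Fin 3) (x y : Site d) : ℝ≥0∞ :=
  if b = 0 then kd x y * (kdc x 0 * L.dbc x) else blockPE L b x y

/-- `P^{S,a} = triv + (P^{S,a} − triv)` pointwise. [cite: FitznerVanDerHofstad2017, App. B Table "definition of P^b(x,y)" rows b = 0 (arXiv:1506.07977v2 p. 73)] -/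
theorem blockPS_eq_blockTriv_add_blockPSn (L : Letters d) (a : Fin 3) (x y : Site d) :
    blockPS L a x y = blockTriv a x y + blockPSn L a x y := by
  by_cases ha : a = 0
  · subst ha
    rw [blockPS_zero]
    unfold blockTriv blockPSn Letters.pdbc kd kdc
    by_cases hxy : x = y
    · subst hxy
      by_cases hx : x = 0
      · subst hx; simp
      · simp [hx]
    · have : ¬(x = 0 ∧ y = 0) := fun h => hxy (h.1.trans h.2.symm)
      simp [hxy, this]
  · unfold blockTriv blockPSn
    simp [ha]

/-- `P^{E,b} = triv + (P^{E,b} − triv)` pointwise. [cite: FitznerVanDerHofstad2017, §5.1 Table "P^{E,b}" (arXiv:1506.07977v2 p. 47)] -/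
theorem blockPE_eq_blockTriv_add_blockPEn (L : Letters d) (b : Fin 3) (x y : Site d) :
    blockPE L b x y = blockTriv b x y + blockPEn L b x y := by
  by_cases hb : b = 0
  · subst hb
    have h := blockPS_eq_blockTriv_add_blockPSn L 0 x y
    unfold blockPSn at h
    unfold blockPEn
    rw [blockPE_zero]
    simpa using h
  · unfold blockTriv blockPEn
    simp [hb]

/-- The `H^{(3)}`-pattern weighting of a four-point family: `‖v − y‖₂² A^{ι,a,b}(u,v,x,y)`
(`wtMid (blockAbarSt L) = blockH3 L`). [cite: FitznerVanDerHofstad2017, App. B "Building blocks with weight", H^{(3)} (arXiv:1506.07977v2 p. 78)] -/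
def wtMid (A : DirBlockFamily d) : DirBlockFamily d := fun ι a b u v x y => wt (v - y) * A ι a b u v x y

/-- `wtMid (Ā^{ι,*}) = H^{(3)}` (definitional). [cite: FitznerVanDerHofstad2017, App. B "Building blocks with weight", H^{(3)} (arXiv:1506.07977v2 p. 78)] -/
theorem wtMid_blockAbarSt (L : Letters d) : wtMid (blockAbarSt L) = blockH3 L := rfl

/-- The weighting `‖y‖₂² Q^b(x,y)` of a two-point family on its second argument (the weighted versions of `Q^S`,
`Q^E`: `‖w‖₂² Q^{S,a}(u,w)` and `‖x−z‖₂² Q^{E,b}(t−x,z−x)`). [cite: FitznerVanDerHofstad2017, §6.1 (lemmapercboundXi1-1-step0.3) (arXiv:1506.07977v2 p. 59)] -/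
def wtSnd (Q : Fin 3 → Site d → Site d → ℝ≥0∞) : Fin 3 → Site d → Site d → ℝ≥0∞ := fun b x y => wt y * Q b x y

/-- The reversed-transposed family `A^{ι,b,a}(t,z,u,w)` of (step0.2). [cite: FitznerVanDerHofstad2017, §6.1 (lemmapercboundXi1-1-step0.2) (arXiv:1506.07977v2 p. 59)] -/
def revT (A : DirBlockFamily d) : DirBlockFamily d := fun ι a b u w t z => A ι b a t z u w

/-- `wtMid` preserves translation invariance. (pointwise property of the weighting `‖x−y‖₂² Ā`). [cite: FitznerVanDerHofstad2017, App. B "Building blocks with weight", H^{(3)} (arXiv:1506.07977v2 p. 78); §6.1 (lemmapercboundXi1-1-step0.2) (p. 59)] -/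
theorem isTransInv_wtMid {A : DirBlockFamily d} (hA : ∀ ι a b, IsTransInv (A ι a b)) (ι : Fin d × Bool)
    (a b : Fin 3) : IsTransInv (wtMid A ι a b) :=
  isTransInv_wt24_mul (hA ι a b)

/-- `revT` preserves translation invariance. (pointwise property of the reversal). [cite: FitznerVanDerHofstad2017, §6.1 (lemmapercboundXi1-1-step0.3) — the reversed middle block of (step0.2) (arXiv:1506.07977v2 p. 59)] -/
theorem isTransInv_revT {A : DirBlockFamily d} (hA : ∀ ι a b, IsTransInv (A ι a b)) (ι : Fin d × Bool)
    (a b : Fin 3) : IsTransInv (revT A ι a b) := by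
  intro g u v x y
  exact hA ι b a g x y u v

/-- The double-open norm of the reversed-transposed family is the transposed matrix:
`sup_{v,y} Σ_x A^{ι,b,a}(x,x+y,0,v) = sup_{v,y} Σ_x A^{ι,b,a}(0,y,x,x+v)` (translate by `−x`, reflect `x ↦ −x`).
[cite: FitznerVanDerHofstad2017, Lemma 5.1 (lemmapercboundXi1-2), the factor `(A^ι)ᵀ` (arXiv:1506.07977v2 p. 50)] -/
theorem matAbar_revT {A : DirBlockFamily d} (hA : ∀ ι a b, IsTransInv (A ι a b)) :
    matAbar (revT A) = (matAbar A)ᵀ := by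
  ext a b
  rw [Matrix.transpose_apply, matAbar_apply, matAbar_apply]
  have key : ∀ (v y x : Site d) (ι : Fin d × Bool), revT A ι a b 0 v x (x + y) = A ι b a 0 y (-x) (-x + v) := by
    intro v y x ι
    have h := hA ι b a (-x) x (y + x) 0 v
    simp only [add_neg_cancel, add_neg_cancel_right, zero_add] at h
    simp only [revT]
    rw [add_comm x y, ← h, neg_add_eq_sub, ← sub_eq_add_neg]
  simp_rw [key]
  rw [iSup_comm]
  refine iSup_congr fun y => iSup_congr fun v => ?_
  simpa using (Equiv.neg (Site d)).tsum_eq (fun x => ∑ ι, A ι b a 0 y x (x + v))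

/-- The double-open norm is at most the closed norm: `sup_{v,y} Σ_x M(0,v,x,x+y) ≤ sup_v Σ_{x,y} M(0,v,x,y)`.
[cite: FitznerVanDerHofstad2017, §5.1 "Elements of the bounds" (arXiv:1506.07977v2 p. 49)] -/
theorem normOO_le_normB (M : Site d → Site d → Site d → Site d → ℝ≥0∞) : normOO M ≤ normB M := by
  unfold normOO normB
  refine iSup_le fun v => iSup_le fun y => le_iSup_of_le v ?_
  exact ENNReal.tsum_le_tsum fun x => ENNReal.le_tsum (x + y)

/-- `matAbar A ≤ matB A` entrywise (so the printed closed norm `(A^ι)_{a,b}` may replace the double-open one).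
[cite: FitznerVanDerHofstad2017, §5.1 "Elements of the bounds" (arXiv:1506.07977v2 p. 49)] -/
theorem matAbar_le_matB (A : DirBlockFamily d) (a b : Fin 3) : matAbar A a b ≤ matB A a b :=
  normOO_le_normB (d := d) fun u v x y => ∑ κ, A κ a b u v x y

/-- **The sup-gap functional of a flank**, `sup_y Λ_F(y) = sup_y Σ_s F(s, s+y)`: the shape of the weighted flank
vectors `(h⃗^S)_b = (H^{(1)})_{0,b}`, `(h⃗^E)_b = (H^{(3)})_{0,b}` of VERSION 1 (one gap summed, one gap sup'd — the
full pair sum of a weighted percolation flank is not a tabulated object).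
[cite: FitznerVanDerHofstad2017, §5.1 "Elements of the bounds", `(h^S)_b = (H^{(1)})_{0,b}`, `(h^E)_b = (H^{(3)})_{0,b}` (arXiv:1506.07977v2 p. 50); §6.1 sentence before (XiIota-Deltabounds-versions1) (p. 60)] -/
def supGap (F : Site d → Site d → ℝ≥0∞) : ℝ≥0∞ := ⨆ y, gapSum F y

/-- The vector of sup-gap functionals of a family of flanks, `(h⃗)_b = sup_y Σ_s F^b(s, s+y)`.
[cite: FitznerVanDerHofstad2017, §5.1 "Elements of the bounds" (arXiv:1506.07977v2 p. 50)] -/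
def vecH (F : Fin 3 → Site d → Site d → ℝ≥0∞) : Fin 3 → ℝ≥0∞ := fun b => supGap (F b)

/-- `gapSum F y ≤ supGap F`: a member is below the supremum over the gap. [cite: FitznerVanDerHofstad2017, §5.1 "Elements of the bounds", `(h^S)_b = (H^{(1)})_{0,b}`, `(h^E)_b = (H^{(3)})_{0,b}` (arXiv:1506.07977v2 p. 50)] -/
theorem gapSum_le_supGap (F : Site d → Site d → ℝ≥0∞) (y : Site d) : gapSum F y ≤ supGap F :=
  le_iSup (gapSum F) y

/-- `(vecH F)_b = sup_y Σ_s F_b(s, s+y)` (definitional unfolding). [cite: FitznerVanDerHofstad2017, §5.1 "Elements of the bounds", `(h^S)_b = (H^{(1)})_{0,b}`, `(h^E)_b = (H^{(3)})_{0,b}` (arXiv:1506.07977v2 p. 50)] -/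
theorem vecH_apply (F : Fin 3 → Site d → Site d → ℝ≥0∞) (b : Fin 3) : vecH F b = ⨆ y, ∑' s, F b s (s + y) := rfl

/-- The sup-gap functional with the weight on the second argument, re-indexed so that the weighted point is the
summation variable: `sup_y Σ_s ‖s+y‖₂² Q(s,s+y) = sup_g Σ_w ‖w‖₂² Q(w+g, w)` (the shape of the row-`0` entries of
`H^{(1)}`, weight on the summed site). (re-indexing of the supremum; the shape of the row-`0` entries). [cite: FitznerVanDerHofstad2017, §5.1 "Elements of the bounds", `(h^S)_b = (H^{(1)})_{0,b}`, `(h^E)_b = (H^{(3)})_{0,b}` (arXiv:1506.07977v2 p. 50)] -/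
theorem supGap_wtSnd_eq (Q : Fin 3 → Site d → Site d → ℝ≥0∞) (b : Fin 3) :
    supGap (wtSnd Q b) = ⨆ g, ∑' w, wt w * Q b (w + g) w := by
  unfold supGap gapSum wtSnd
  refine Equiv.iSup_congr (Equiv.neg (Site d)) fun y => ?_
  show ∑' w, wt w * Q b (w + -y) w = ∑' s, wt (s + y) * Q b s (s + y)
  rw [← tsum_sub_right_eq (fun s => wt (s + y) * Q b s (s + y)) y]
  exact tsum_congr fun w => by simp only [sub_add_cancel, ← sub_eq_add_neg]

/-! ## C. The integrand of VERSION 1 and the pointwise `u⃗`-extraction -/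

/-- **The eight-term integrand of (XiIota-Deltabounds-versions1)** at `x`, for the direction `ι`, classes `(a,b)` and
vertices `(u,w,t,z)`: `triv·H·triv + 2 triv·H·P^E_n + 2 triv·A·(wQ^E) + 2 (wQ^S)·Aᵀ·triv + 2 P^S_n·H·triv
+ 3 (wQ^S)·Aᵀ·P^E_n + 3 P^S_n·H·P^E_n + 3 P^S_n·A·(wQ^E)` with `H = wtMid Ā`, `wQ = wtSnd Q`, `Aᵀ = revT A`.
[cite: FitznerVanDerHofstad2017, §6.1 (XiIota-Deltabounds-versions1) (arXiv:1506.07977v2 p. 60)] -/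
def v1Integrand (PSn QS PEn QE : Fin 3 → Site d → Site d → ℝ≥0∞) (Ab Am : DirBlockFamily d) (x : Site d)
    (ι : Fin d × Bool) (a b : Fin 3) (u w t z : Site d) : ℝ≥0∞ :=
  blockTriv a u w * wtMid Ab ι a b u w t z * blockTriv b (t - x) (z - x)
  + 2 * (blockTriv a u w * wtMid Ab ι a b u w t z * PEn b (t - x) (z - x))
  + 2 * (blockTriv a u w * Am ι a b u w t z * wtSnd QE b (t - x) (z - x))
  + 2 * (wtSnd QS a u w * revT Am ι a b u w t z * blockTriv b (t - x) (z - x))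
  + 2 * (PSn a u w * wtMid Ab ι a b u w t z * blockTriv b (t - x) (z - x))
  + 3 * (wtSnd QS a u w * revT Am ι a b u w t z * PEn b (t - x) (z - x))
  + 3 * (PSn a u w * wtMid Ab ι a b u w t z * PEn b (t - x) (z - x))
  + 3 * (PSn a u w * Am ι a b u w t z * wtSnd QE b (t - x) (z - x))

section Pointwise

variable (PS PSn QS PE PEn QE : Fin 3 → Site d → Site d → ℝ≥0∞) (Ab Am : DirBlockFamily d)

/- Algebra of the four cases: `LHS + R = V₁` for an explicit non-negative remainder `R`. -/

/-- Case both triangles non-trivial: `(Ta+Sn)H(Tb+En) ≤ V₁`-shaped sum (semiring algebra in `[0,∞]`). [folklore] -/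
private theorem caseA_le (Ta Tb Sn En H A AT wS wE : ℝ≥0∞) :
    (Ta + Sn) * H * (Tb + En) ≤
      Ta * H * Tb + 2 * (Ta * H * En) + 2 * (Ta * A * wE) + 2 * (wS * AT * Tb) + 2 * (Sn * H * Tb)
        + 3 * (wS * AT * En) + 3 * (Sn * H * En) + 3 * (Sn * A * wE) := by
  calc (Ta + Sn) * H * (Tb + En)
      ≤ (Ta + Sn) * H * (Tb + En) + (Ta * H * En + 2 * (Ta * A * wE) + 2 * (wS * AT * Tb) + Sn * H * Tb
          + 3 * (wS * AT * En) + 2 * (Sn * H * En) + 3 * (Sn * A * wE)) := le_self_add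
    _ = _ := by ring

/-- Case right triangle trivial (`Tb`-slot `0`): `2(Ta+Sn)H En + 2(Ta+Sn)A wE ≤ V₁`-shaped sum. [folklore] -/
private theorem caseB_le (Ta Sn En H A AT wS wE : ℝ≥0∞) :
    2 * ((Ta + Sn) * H * En) + 2 * ((Ta + Sn) * A * wE) ≤
      Ta * H * 0 + 2 * (Ta * H * En) + 2 * (Ta * A * wE) + 2 * (wS * AT * 0) + 2 * (Sn * H * 0)
        + 3 * (wS * AT * En) + 3 * (Sn * H * En) + 3 * (Sn * A * wE) := by
  calc 2 * ((Ta + Sn) * H * En) + 2 * ((Ta + Sn) * A * wE)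
      ≤ 2 * ((Ta + Sn) * H * En) + 2 * ((Ta + Sn) * A * wE)
          + (3 * (wS * AT * En) + Sn * H * En + Sn * A * wE) := le_self_add
    _ = _ := by ring

/-- Case left triangle trivial (`Ta`-slot `0`): `2 wS Aᵀ(Tb+En) + 2 Sn H(Tb+En) ≤ V₁`-shaped sum. [folklore] -/
private theorem caseC_le (Tb Sn En H A AT wS wE : ℝ≥0∞) :
    2 * (wS * AT * (Tb + En)) + 2 * (Sn * H * (Tb + En)) ≤
      0 * H * Tb + 2 * (0 * H * En) + 2 * (0 * A * wE) + 2 * (wS * AT * Tb) + 2 * (Sn * H * Tb)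
        + 3 * (wS * AT * En) + 3 * (Sn * H * En) + 3 * (Sn * A * wE) := by
  calc 2 * (wS * AT * (Tb + En)) + 2 * (Sn * H * (Tb + En))
      ≤ 2 * (wS * AT * (Tb + En)) + 2 * (Sn * H * (Tb + En))
          + (wS * AT * En + Sn * H * En + 3 * (Sn * A * wE)) := le_self_add
    _ = _ := by ring

/-- Case both triangles trivial (`Ta = Tb = 0` slots): the three coefficient-`3` terms are already in `V₁`. [folklore] -/
private theorem caseD_le (Sn En H A AT wS wE : ℝ≥0∞) :
    3 * (wS * AT * En) + 3 * (Sn * H * En) + 3 * (Sn * A * wE) ≤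
      0 * H * 0 + 2 * (0 * H * En) + 2 * (0 * A * wE) + 2 * (wS * AT * 0) + 2 * (Sn * H * 0)
        + 3 * (wS * AT * En) + 3 * (Sn * H * En) + 3 * (Sn * A * wE) := by
  simp only [zero_mul, mul_zero, zero_add, add_zero, le_refl]

/-- **The `u⃗`-extraction, pointwise** ("for each given configuration"): from the three estimates (step0), (step0.1),
(step0.2) of one class term `X` (any coefficients `c_ι ≥ 0`, e.g. `𝟙{v = u + e_ι}`) to `‖x‖₂² X ≤ Σ_ι c_ι V₁`.
Cases: `w = 0 ∧ z = x` — weight `‖x‖₂² = ‖w − z‖₂²` on `Ā` (factor 1); `w = 0, z ≠ x` — `‖x‖₂² ≤ 2(‖z‖₂² +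
‖x−z‖₂²)` on (step0), (step0.1); `w ≠ 0, z = x` — `‖x‖₂² ≤ 2(‖w‖₂² + ‖x−w‖₂²)` on (step0.2), (step0); otherwise the
factor-`3` split on all three; then `P^S = triv + P^S_n`, `P^E = triv + P^E_n` (`triv = 0` off `w = 0` resp. `z = x`).
[cite: FitznerVanDerHofstad2017, §6.1 proof of Lemma 5.1, (lemmapercboundXi1-1-step0.3)–(XiIota-Deltabounds-versions1) (arXiv:1506.07977v2 pp. 59–60)] -/
theorem wt_mul_le_sum_v1Integrand {X : ℝ≥0∞} {x u w t z : Site d} {a b : Fin 3}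
    (c : Fin d × Bool → ℝ≥0∞)
    (hPS : PS a u w = blockTriv a u w + PSn a u w)
    (hPE : PE b (t - x) (z - x) = blockTriv b (t - x) (z - x) + PEn b (t - x) (z - x))
    (h0 : X ≤ ∑ ι, c ι * (PS a u w * Ab ι a b u w t z * PE b (t - x) (z - x)))
    (h1 : X ≤ ∑ ι, c ι * (PS a u w * Am ι a b u w t z * QE b (t - x) (z - x)))
    (h2 : X ≤ ∑ ι, c ι * (QS a u w * Am ι b a t z u w * PE b (t - x) (z - x))) :
    wt x * X ≤ ∑ ι, c ι * v1Integrand PSn QS PEn QE Ab Am x ι a b u w t z := by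
  -- abbreviations for the three estimates multiplied by a weight
  have hmul : ∀ (ω : ℝ≥0∞) (F : Fin d × Bool → ℝ≥0∞), X ≤ ∑ ι, c ι * F ι →
      ω * X ≤ ∑ ι, c ι * (ω * F ι) := by
    intro ω F hF
    calc ω * X ≤ ω * ∑ ι, c ι * F ι := mul_le_mul' le_rfl hF
      _ = ∑ ι, c ι * (ω * F ι) := by rw [Finset.mul_sum]; exact Finset.sum_congr rfl fun ι _ => by ring
  by_cases hw : w = 0
  · by_cases hz : z = x
    · -- both trivial: `‖x‖² = ‖w − z‖²`, estimate (step0)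
      have hwt : wt x = wt (w - z) := by rw [hw, hz, zero_sub, wt_neg]
      calc wt x * X ≤ ∑ ι, c ι * (wt (w - z) * (PS a u w * Ab ι a b u w t z * PE b (t - x) (z - x))) := by
            rw [hwt]; exact hmul _ _ h0
        _ ≤ ∑ ι, c ι * v1Integrand PSn QS PEn QE Ab Am x ι a b u w t z := by
            refine Finset.sum_le_sum fun ι _ => mul_le_mul' le_rfl ?_
            rw [hPS, hPE, show wt (w - z) * ((blockTriv a u w + PSn a u w) * Ab ι a b u w t z
                * (blockTriv b (t - x) (z - x) + PEn b (t - x) (z - x)))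
                = (blockTriv a u w + PSn a u w) * wtMid Ab ι a b u w t z
                  * (blockTriv b (t - x) (z - x) + PEn b (t - x) (z - x)) by unfold wtMid; ring]
            have h := caseA_le (blockTriv a u w) (blockTriv b (t - x) (z - x)) (PSn a u w) (PEn b (t - x) (z - x))
              (wtMid Ab ι a b u w t z) (Am ι a b u w t z) (revT Am ι a b u w t z) (wtSnd QS a u w)
              (wtSnd QE b (t - x) (z - x))
            unfold v1Integrand; exact h
    · -- `w = 0`, right triangle non-trivial: `‖x‖² ≤ 2(‖z‖² + ‖x − z‖²)`, estimates (step0), (step0.1)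
      have hTb : blockTriv b (t - x) (z - x) = 0 := blockTriv_of_ne (sub_ne_zero.2 hz)
      have hwt : wt x ≤ 2 * wt (w - z) + 2 * wt (z - x) := by
        rw [hw, ← mul_add]; exact wt_le_two_split_right x z
      calc wt x * X ≤ (2 * wt (w - z) + 2 * wt (z - x)) * X := mul_le_mul' hwt le_rfl
        _ = 2 * wt (w - z) * X + 2 * wt (z - x) * X := add_mul _ _ _
        _ ≤ ∑ ι, c ι * (2 * wt (w - z) * (PS a u w * Ab ι a b u w t z * PE b (t - x) (z - x)))
            + ∑ ι, c ι * (2 * wt (z - x) * (PS a u w * Am ι a b u w t z * QE b (t - x) (z - x))) :=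
            add_le_add (hmul _ _ h0) (hmul _ _ h1)
        _ = ∑ ι, c ι * (2 * wt (w - z) * (PS a u w * Ab ι a b u w t z * PE b (t - x) (z - x))
            + 2 * wt (z - x) * (PS a u w * Am ι a b u w t z * QE b (t - x) (z - x))) := by
            rw [← Finset.sum_add_distrib]; exact Finset.sum_congr rfl fun ι _ => by ring
        _ ≤ ∑ ι, c ι * v1Integrand PSn QS PEn QE Ab Am x ι a b u w t z := by
            refine Finset.sum_le_sum fun ι _ => mul_le_mul' le_rfl ?_
            have hPE' : PE b (t - x) (z - x) = PEn b (t - x) (z - x) := by rw [hPE, hTb, zero_add]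
            rw [hPS, hPE', show 2 * wt (w - z) * ((blockTriv a u w + PSn a u w) * Ab ι a b u w t z * PEn b (t - x) (z - x))
                + 2 * wt (z - x) * ((blockTriv a u w + PSn a u w) * Am ι a b u w t z * QE b (t - x) (z - x))
                = 2 * ((blockTriv a u w + PSn a u w) * wtMid Ab ι a b u w t z * PEn b (t - x) (z - x))
                  + 2 * ((blockTriv a u w + PSn a u w) * Am ι a b u w t z * wtSnd QE b (t - x) (z - x)) by
                  unfold wtMid wtSnd; ring]
            have h := caseB_le (blockTriv a u w) (PSn a u w) (PEn b (t - x) (z - x)) (wtMid Ab ι a b u w t z)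
              (Am ι a b u w t z) (revT Am ι a b u w t z) (wtSnd QS a u w) (wtSnd QE b (t - x) (z - x))
            unfold v1Integrand; rw [hTb]; exact h
  · by_cases hz : z = x
    · -- `z = x`, left triangle non-trivial: `‖x‖² ≤ 2(‖w‖² + ‖x − w‖²)`, estimates (step0.2), (step0)
      have hTa : blockTriv a u w = 0 := blockTriv_of_ne hw
      have hwt : wt x ≤ 2 * wt w + 2 * wt (w - z) := by
        rw [hz, ← mul_add]; exact wt_le_two_split_left x w
      calc wt x * X ≤ (2 * wt w + 2 * wt (w - z)) * X := mul_le_mul' hwt le_rfl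
        _ = 2 * wt w * X + 2 * wt (w - z) * X := add_mul _ _ _
        _ ≤ ∑ ι, c ι * (2 * wt w * (QS a u w * Am ι b a t z u w * PE b (t - x) (z - x)))
            + ∑ ι, c ι * (2 * wt (w - z) * (PS a u w * Ab ι a b u w t z * PE b (t - x) (z - x))) :=
            add_le_add (hmul _ _ h2) (hmul _ _ h0)
        _ = ∑ ι, c ι * (2 * wt w * (QS a u w * Am ι b a t z u w * PE b (t - x) (z - x))
            + 2 * wt (w - z) * (PS a u w * Ab ι a b u w t z * PE b (t - x) (z - x))) := by
            rw [← Finset.sum_add_distrib]; exact Finset.sum_congr rfl fun ι _ => by ring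
        _ ≤ ∑ ι, c ι * v1Integrand PSn QS PEn QE Ab Am x ι a b u w t z := by
            refine Finset.sum_le_sum fun ι _ => mul_le_mul' le_rfl ?_
            have hPS' : PS a u w = PSn a u w := by rw [hPS, hTa, zero_add]
            rw [hPS', hPE, show 2 * wt w * (QS a u w * Am ι b a t z u w * (blockTriv b (t - x) (z - x) + PEn b (t - x) (z - x)))
                + 2 * wt (w - z) * (PSn a u w * Ab ι a b u w t z * (blockTriv b (t - x) (z - x) + PEn b (t - x) (z - x)))
                = 2 * (wtSnd QS a u w * revT Am ι a b u w t z * (blockTriv b (t - x) (z - x) + PEn b (t - x) (z - x)))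
                  + 2 * (PSn a u w * wtMid Ab ι a b u w t z * (blockTriv b (t - x) (z - x) + PEn b (t - x) (z - x))) by
                  unfold wtMid wtSnd revT; ring]
            have h := caseC_le (blockTriv b (t - x) (z - x)) (PSn a u w) (PEn b (t - x) (z - x))
              (wtMid Ab ι a b u w t z) (Am ι a b u w t z) (revT Am ι a b u w t z) (wtSnd QS a u w)
              (wtSnd QE b (t - x) (z - x))
            unfold v1Integrand; rw [hTa]; exact h
    · -- neither: the factor-3 split on (step0.2), (step0), (step0.1)
      have hTa : blockTriv a u w = 0 := blockTriv_of_ne hw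
      have hTb : blockTriv b (t - x) (z - x) = 0 := blockTriv_of_ne (sub_ne_zero.2 hz)
      have hwt : wt x ≤ 3 * wt w + 3 * wt (w - z) + 3 * wt (z - x) := by
        rw [← mul_add, ← mul_add]; exact wt_le_three_split x w z
      calc wt x * X ≤ (3 * wt w + 3 * wt (w - z) + 3 * wt (z - x)) * X := mul_le_mul' hwt le_rfl
        _ = 3 * wt w * X + 3 * wt (w - z) * X + 3 * wt (z - x) * X := by rw [add_mul, add_mul]
        _ ≤ ∑ ι, c ι * (3 * wt w * (QS a u w * Am ι b a t z u w * PE b (t - x) (z - x)))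
            + ∑ ι, c ι * (3 * wt (w - z) * (PS a u w * Ab ι a b u w t z * PE b (t - x) (z - x)))
            + ∑ ι, c ι * (3 * wt (z - x) * (PS a u w * Am ι a b u w t z * QE b (t - x) (z - x))) :=
            add_le_add (add_le_add (hmul _ _ h2) (hmul _ _ h0)) (hmul _ _ h1)
        _ = ∑ ι, c ι * (3 * wt w * (QS a u w * Am ι b a t z u w * PE b (t - x) (z - x))
            + 3 * wt (w - z) * (PS a u w * Ab ι a b u w t z * PE b (t - x) (z - x))
            + 3 * wt (z - x) * (PS a u w * Am ι a b u w t z * QE b (t - x) (z - x))) := by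
            rw [← Finset.sum_add_distrib, ← Finset.sum_add_distrib]
            exact Finset.sum_congr rfl fun ι _ => by ring
        _ ≤ ∑ ι, c ι * v1Integrand PSn QS PEn QE Ab Am x ι a b u w t z := by
            refine Finset.sum_le_sum fun ι _ => mul_le_mul' le_rfl ?_
            have hPS' : PS a u w = PSn a u w := by rw [hPS, hTa, zero_add]
            have hPE' : PE b (t - x) (z - x) = PEn b (t - x) (z - x) := by rw [hPE, hTb, zero_add]
            rw [hPS', hPE', show 3 * wt w * (QS a u w * Am ι b a t z u w * PEn b (t - x) (z - x))
                + 3 * wt (w - z) * (PSn a u w * Ab ι a b u w t z * PEn b (t - x) (z - x))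
                + 3 * wt (z - x) * (PSn a u w * Am ι a b u w t z * QE b (t - x) (z - x))
                = 3 * (wtSnd QS a u w * revT Am ι a b u w t z * PEn b (t - x) (z - x))
                  + 3 * (PSn a u w * wtMid Ab ι a b u w t z * PEn b (t - x) (z - x))
                  + 3 * (PSn a u w * Am ι a b u w t z * wtSnd QE b (t - x) (z - x)) by
                  unfold wtMid wtSnd revT; ring]
            have h := caseD_le (PSn a u w) (PEn b (t - x) (z - x)) (wtMid Ab ι a b u w t z) (Am ι a b u w t z)
              (revT Am ι a b u w t z) (wtSnd QS a u w) (wtSnd QE b (t - x) (z - x))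
            unfold v1Integrand; rw [hTa, hTb]; exact h

end Pointwise

/-! ## C″. The integrand of VERSION 2 in raw form: the one-side-trivial configurations carried unsplit -/

/-- `blockTriv a x y = 1` on the trivial data `a = 0, x = y = 0`. (evaluation of the Kronecker deltas of the trivial piece). [cite: FitznerVanDerHofstad2017, §6.1 proof of Lemma 5.1, sentence before (XiIota-Deltabounds-versions1) — the trivial triangle `u⃗ᵀ = (1,0,0)` split off `P^{S,0}`/`P^{E,0}` (arXiv:1506.07977v2 p. 60)] -/
theorem blockTriv_eq_one {a : Fin 3} {x y : Site d} (h : a = 0 ∧ x = 0 ∧ y = 0) : blockTriv a x y = 1 := by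
  simp [blockTriv, h]

/-- `blockTriv a x y = 0` off the trivial data. (evaluation of the Kronecker deltas of the trivial piece). [cite: FitznerVanDerHofstad2017, §6.1 proof of Lemma 5.1, sentence before (XiIota-Deltabounds-versions1) — the trivial triangle `u⃗ᵀ = (1,0,0)` split off `P^{S,0}`/`P^{E,0}` (arXiv:1506.07977v2 p. 60)] -/
theorem blockTriv_eq_zero {a : Fin 3} {x y : Site d} (h : ¬(a = 0 ∧ x = 0 ∧ y = 0)) : blockTriv a x y = 0 := by
  simp only [blockTriv, if_neg h]

/-- The non-trivial pieces vanish on the trivial data: `P^S_n(0,0) = 0` in every class. [cite: FitznerVanDerHofstad2017, App. B Table "definition of P^b(x,y)" (arXiv:1506.07977v2 p. 73)] -/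
theorem blockPSn_zero_zero (L : Letters d) (a : Fin 3) : blockPSn L a 0 0 = 0 := by
  rcases a with ⟨_ | _ | _ | n, ha⟩
  · simp [blockPSn, kdc]
  · simp [blockPSn, blockPS, kdc]
  · simp [blockPSn, blockPS, Fin.ext_iff, kdc]
  · exfalso; omega

/-- `P^E_n(s,0) = 0` in every class ("for `P^{E,b}` we know that `y ≠ 0`"; in class `0`, `δ_{s,0}(1−δ_{0,s}) = 0`):
the data `z = x` IS "the right triangle is trivial". [cite: FitznerVanDerHofstad2017, §5.1 Table "P^{E,b}" (arXiv:1506.07977v2 p. 47); App. C.1 "the right triangle is trivial, i.e., t = z = x" (arXiv:1506.07977v2 p. 79; TeX `AdditionalBoundForLongVersion.tex` l.19)] -/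
theorem blockPEn_zero_right (L : Letters d) (b : Fin 3) (s : Site d) : blockPEn L b s 0 = 0 := by
  rcases b with ⟨_ | _ | _ | n, hb⟩
  · by_cases hs : s = 0
    · simp [blockPEn, hs, kd, kdc]
    · simp [blockPEn, kd, hs]
  · simp [blockPEn, blockPE, kdc]
  · simp [blockPEn, blockPE, Fin.ext_iff, kdc]
  · exfalso; omega

/-- Class `0` of `P^S − u⃗`: the non-trivial double connection `δ_{u,w}(1−δ_{0,u}) P(0 ⇔ u)`.
[cite: FitznerVanDerHofstad2017, App. B Table "definition of P^b(x,y)" row b = 0 (arXiv:1506.07977v2 p. 73)] -/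
theorem blockPSn_zero_eq (L : Letters d) (u w : Site d) : blockPSn L 0 u w = kd u w * (kdc u 0 * L.dbc u) := by
  simp [blockPSn]

/-- Class `0` of `P^E − u⃗` (`P^{E,0} = P^{S,0}`). [cite: FitznerVanDerHofstad2017, §5.1 Table "P^{E,b}" (arXiv:1506.07977v2 p. 47)] -/
theorem blockPEn_zero_eq (L : Letters d) (s s' : Site d) : blockPEn L 0 s s' = kd s s' * (kdc s 0 * L.dbc s) := by
  simp [blockPEn]

/-- Classes `1, 2` of `P^S − u⃗` are the letters `P^{S,1}`, `P^{S,2}` themselves. [cite: FitznerVanDerHofstad2017, §6.1 (XiIota-Deltabounds-versions1) (arXiv:1506.07977v2 p. 60)] -/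
theorem blockPSn_of_ne_zero (L : Letters d) {a : Fin 3} (ha : a ≠ 0) (u w : Site d) :
    blockPSn L a u w = blockPS L a u w := by
  simp [blockPSn, ha]

/-- Classes `1, 2` of `P^E − u⃗` are the letters `P^{E,1}`, `P^{E,2}` themselves. [cite: FitznerVanDerHofstad2017, §6.1 (XiIota-Deltabounds-versions1) (arXiv:1506.07977v2 p. 60)] -/
theorem blockPEn_of_ne_zero (L : Letters d) {b : Fin 3} (hb : b ≠ 0) (s s' : Site d) :
    blockPEn L b s s' = blockPE L b s s' := by
  simp [blockPEn, hb]

/-- **The six-term integrand of VERSION 2 in raw form** at `x`: `triv·H·triv + ‖x‖₂²·(P^S_n·Ā·triv)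
+ ‖x‖₂²·(triv·Ā·P^E_n) + 3 (wQ^S)·Aᵀ·P^E_n + 3 P^S_n·H·P^E_n + 3 P^S_n·A·(wQ^E)`.  The configurations in which
EXACTLY ONE of the two triangles is trivial (left: `a = 0, u = w = 0`; right: `t = z = x`) keep their weight `‖x‖₂²`
UNSPLIT on the (step0) product — these two raw terms are what App. C.1 re-bounds diagram by diagram ("we create
these bounds initially in the same ways as explained above. Then, we bound the terms (XiIota-Delta-trivial-triangle)
by a better bound. These terms correspond to the cases in which either the left or the right diagram are trivial");
both-trivial configurations carry `‖x‖₂² = ‖w − z‖₂²` on `Ā` (`u⃗ᵀ H u⃗`); all others the factor-`3` split.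
[cite: FitznerVanDerHofstad2017, Lemma 5.1 (lemmapercboundXi1-2) second version (arXiv:1506.07977v2 p. 50; TeX `Bounds/BoundNOne.tex` l.19–30); App. C.1 first paragraph (arXiv:1506.07977v2 p. 79; TeX `AdditionalBoundForLongVersion.tex` l.9–21)] -/
def v2Integrand (PSn QS PEn QE : Fin 3 → Site d → Site d → ℝ≥0∞) (Ab Am : DirBlockFamily d) (x : Site d)
    (ι : Fin d × Bool) (a b : Fin 3) (u w t z : Site d) : ℝ≥0∞ :=
  blockTriv a u w * wtMid Ab ι a b u w t z * blockTriv b (t - x) (z - x)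
  + wt x * (PSn a u w * Ab ι a b u w t z * blockTriv b (t - x) (z - x))
  + wt x * (blockTriv a u w * Ab ι a b u w t z * PEn b (t - x) (z - x))
  + 3 * (wtSnd QS a u w * revT Am ι a b u w t z * PEn b (t - x) (z - x))
  + 3 * (PSn a u w * wtMid Ab ι a b u w t z * PEn b (t - x) (z - x))
  + 3 * (PSn a u w * Am ι a b u w t z * wtSnd QE b (t - x) (z - x))

section PointwiseV2

variable (PS PSn QS PE PEn QE : Fin 3 → Site d → Site d → ℝ≥0∞) (Ab Am : DirBlockFamily d)

/-- **The `u⃗`-extraction of VERSION 2, pointwise, raw form.**  From the three estimates (step0), (step0.1), (step0.2)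
of one class term `X` to `‖x‖₂² X ≤ Σ_ι c_ι V₂^{raw}`.  Cases on the data: LEFT TRIVIAL `a = 0 ∧ u = w = 0` (then
`P^{S,a}(u,w) = triv = 1`, as `P^S_n(0,0) = 0`), RIGHT TRIVIAL `z = x` (then `P^{E,b}(t−x,z−x) = triv`, as
`P^E_n(·,0) = 0`): both ⇒ weight `‖w − z‖₂²` on `Ā` with (step0); exactly one ⇒ `‖x‖₂²` kept on (step0), unsplit;
none ⇒ the factor-`3` split on (step0.2), (step0), (step0.1).
[cite: FitznerVanDerHofstad2017, §6.1 proof of Lemma 5.1, (lemmapercboundXi1-1-step0.3)–(XiIota-Deltabounds-versions1) (arXiv:1506.07977v2 pp. 59–60); App. C.1 first paragraph (arXiv:1506.07977v2 p. 79; TeX `AdditionalBoundForLongVersion.tex` l.9–21)] -/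
theorem wt_mul_le_sum_v2Integrand {X : ℝ≥0∞} {x u w t z : Site d} {a b : Fin 3}
    (c : Fin d × Bool → ℝ≥0∞)
    (hPS : PS a u w = blockTriv a u w + PSn a u w)
    (hPE : PE b (t - x) (z - x) = blockTriv b (t - x) (z - x) + PEn b (t - x) (z - x))
    (hSn0 : PSn a 0 0 = 0) (hEn0 : PEn b (t - x) 0 = 0)
    (h0 : X ≤ ∑ ι, c ι * (PS a u w * Ab ι a b u w t z * PE b (t - x) (z - x)))
    (h1 : X ≤ ∑ ι, c ι * (PS a u w * Am ι a b u w t z * QE b (t - x) (z - x)))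
    (h2 : X ≤ ∑ ι, c ι * (QS a u w * Am ι b a t z u w * PE b (t - x) (z - x))) :
    wt x * X ≤ ∑ ι, c ι * v2Integrand PSn QS PEn QE Ab Am x ι a b u w t z := by
  have hmul : ∀ (ω : ℝ≥0∞) (F : Fin d × Bool → ℝ≥0∞), X ≤ ∑ ι, c ι * F ι →
      ω * X ≤ ∑ ι, c ι * (ω * F ι) := by
    intro ω F hF
    calc ω * X ≤ ω * ∑ ι, c ι * F ι := mul_le_mul' le_rfl hF
      _ = ∑ ι, c ι * (ω * F ι) := by rw [Finset.mul_sum]; exact Finset.sum_congr rfl fun ι _ => by ring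
  by_cases hT : a = 0 ∧ u = 0 ∧ w = 0
  · -- the left triangle is trivial
    have hTa : blockTriv a u w = 1 := blockTriv_eq_one hT
    have hSn : PSn a u w = 0 := by rw [hT.2.1, hT.2.2]; exact hSn0
    have hPS' : PS a u w = 1 := by rw [hPS, hTa, hSn, add_zero]
    by_cases hz : z = x
    · -- both trivial: `‖x‖² = ‖w − z‖²` on `Ā`, estimate (step0)
      have hEn : PEn b (t - x) (z - x) = 0 := by rw [hz, sub_self]; exact hEn0
      have hPE' : PE b (t - x) (z - x) = blockTriv b (t - x) (z - x) := by rw [hPE, hEn, add_zero]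
      have hwt : wt x = wt (w - z) := by rw [hT.2.2, hz, zero_sub, wt_neg]
      calc wt x * X ≤ ∑ ι, c ι * (wt (w - z) * (PS a u w * Ab ι a b u w t z * PE b (t - x) (z - x))) := by
            rw [hwt]; exact hmul _ _ h0
        _ ≤ ∑ ι, c ι * v2Integrand PSn QS PEn QE Ab Am x ι a b u w t z := by
            refine Finset.sum_le_sum fun ι _ => mul_le_mul' le_rfl ?_
            rw [hPS', hPE']
            unfold v2Integrand wtMid
            rw [hTa]
            calc wt (w - z) * (1 * Ab ι a b u w t z * blockTriv b (t - x) (z - x))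
                = 1 * (wt (w - z) * Ab ι a b u w t z) * blockTriv b (t - x) (z - x) := by ring
              _ ≤ _ := le_add_right (le_add_right (le_add_right (le_add_right (le_add_right le_rfl))))
    · -- left trivial, right not: `‖x‖²` kept on (step0)
      have hTb : blockTriv b (t - x) (z - x) = 0 := blockTriv_of_ne (sub_ne_zero.2 hz)
      have hPE' : PE b (t - x) (z - x) = PEn b (t - x) (z - x) := by rw [hPE, hTb, zero_add]
      calc wt x * X ≤ ∑ ι, c ι * (wt x * (PS a u w * Ab ι a b u w t z * PE b (t - x) (z - x))) := hmul _ _ h0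
        _ ≤ ∑ ι, c ι * v2Integrand PSn QS PEn QE Ab Am x ι a b u w t z := by
            refine Finset.sum_le_sum fun ι _ => mul_le_mul' le_rfl ?_
            rw [hPS', hPE']
            unfold v2Integrand
            rw [hTa]
            exact le_add_right (le_add_right (le_add_right le_add_self))
  · -- the left triangle is not trivial
    have hTa : blockTriv a u w = 0 := blockTriv_eq_zero hT
    have hPS' : PS a u w = PSn a u w := by rw [hPS, hTa, zero_add]
    by_cases hz : z = x
    · -- right trivial, left not: `‖x‖²` kept on (step0)
      have hEn : PEn b (t - x) (z - x) = 0 := by rw [hz, sub_self]; exact hEn0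
      have hPE' : PE b (t - x) (z - x) = blockTriv b (t - x) (z - x) := by rw [hPE, hEn, add_zero]
      calc wt x * X ≤ ∑ ι, c ι * (wt x * (PS a u w * Ab ι a b u w t z * PE b (t - x) (z - x))) := hmul _ _ h0
        _ ≤ ∑ ι, c ι * v2Integrand PSn QS PEn QE Ab Am x ι a b u w t z := by
            refine Finset.sum_le_sum fun ι _ => mul_le_mul' le_rfl ?_
            rw [hPS', hPE']
            unfold v2Integrand
            exact le_add_right (le_add_right (le_add_right (le_add_right le_add_self)))
    · -- neither: the factor-3 split on (step0.2), (step0), (step0.1)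
      have hTb : blockTriv b (t - x) (z - x) = 0 := blockTriv_of_ne (sub_ne_zero.2 hz)
      have hPE' : PE b (t - x) (z - x) = PEn b (t - x) (z - x) := by rw [hPE, hTb, zero_add]
      have hwt : wt x ≤ 3 * wt w + 3 * wt (w - z) + 3 * wt (z - x) := by
        rw [← mul_add, ← mul_add]; exact wt_le_three_split x w z
      calc wt x * X ≤ (3 * wt w + 3 * wt (w - z) + 3 * wt (z - x)) * X := mul_le_mul' hwt le_rfl
        _ = 3 * wt w * X + 3 * wt (w - z) * X + 3 * wt (z - x) * X := by rw [add_mul, add_mul]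
        _ ≤ ∑ ι, c ι * (3 * wt w * (QS a u w * Am ι b a t z u w * PE b (t - x) (z - x)))
            + ∑ ι, c ι * (3 * wt (w - z) * (PS a u w * Ab ι a b u w t z * PE b (t - x) (z - x)))
            + ∑ ι, c ι * (3 * wt (z - x) * (PS a u w * Am ι a b u w t z * QE b (t - x) (z - x))) :=
            add_le_add (add_le_add (hmul _ _ h2) (hmul _ _ h0)) (hmul _ _ h1)
        _ = ∑ ι, c ι * (3 * wt w * (QS a u w * Am ι b a t z u w * PE b (t - x) (z - x))
            + 3 * wt (w - z) * (PS a u w * Ab ι a b u w t z * PE b (t - x) (z - x))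
            + 3 * wt (z - x) * (PS a u w * Am ι a b u w t z * QE b (t - x) (z - x))) := by
            rw [← Finset.sum_add_distrib, ← Finset.sum_add_distrib]
            exact Finset.sum_congr rfl fun ι _ => by ring
        _ ≤ ∑ ι, c ι * v2Integrand PSn QS PEn QE Ab Am x ι a b u w t z := by
            refine Finset.sum_le_sum fun ι _ => mul_le_mul' le_rfl ?_
            rw [hPS', hPE', show 3 * wt w * (QS a u w * Am ι b a t z u w * PEn b (t - x) (z - x))
                + 3 * wt (w - z) * (PSn a u w * Ab ι a b u w t z * PEn b (t - x) (z - x))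
                + 3 * wt (z - x) * (PSn a u w * Am ι a b u w t z * QE b (t - x) (z - x))
                = 3 * (wtSnd QS a u w * revT Am ι a b u w t z * PEn b (t - x) (z - x))
                  + 3 * (PSn a u w * wtMid Ab ι a b u w t z * PEn b (t - x) (z - x))
                  + 3 * (PSn a u w * Am ι a b u w t z * wtSnd QE b (t - x) (z - x)) by
                  unfold wtMid wtSnd revT; ring]
            unfold v2Integrand
            exact add_le_add (add_le_add le_add_self le_rfl) le_rfl

end PointwiseV2

end NobleBlocks

/-! ## D. The `x`-space bound over the two-level percolation space (weighted twin of `nobleXiT_one_le_blocks_of_cls`) -/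

/-- **(lemmapercboundXi1-1-step0.3) with the `u⃗`-extraction, `x`-space form.**  From the joint two-level form
`Ξ(x) ≤ Σ_{(u,v)} Σ_{w,z,t} J(v−u) ℙ^{⊗2}(E(u,v,w,z,t))` and, per class `(a,b)`, the THREE estimates of
`J(v−u) ℙ^{⊗2}(E ∩ class(a,b))` — (step0) by `P^{S,a} Ā^{ι,a,b} P^{E,b}`, (step0.1) by `P^{S,a} A^{ι,a,b} Q^{E,b}`,
(step0.2) by `Q^{S,a}(u,w) A^{ι,b,a}(t,z,u,w) P^{E,b}` — conclude
`‖x‖₂² Ξ(x) ≤ Σ_{u,w,t,z} Σ_{ι,a,b} V₁(x;ι,a,b,u,w,t,z)`.  Letters, blocks and the event family are parameters.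
[cite: FitznerVanDerHofstad2017, §6.1 proof of Lemma 5.1, (lemmapercboundXi1-1-step0)–(XiIota-Deltabounds-versions1) (arXiv:1506.07977v2 pp. 58–60)] -/
theorem wt_mul_le_blocks_v1_of_cls (p : unitInterval) (x : Site d) (Ξx : ℝ≥0∞)
    (E : Site d → Site d → Site d → Site d → Site d → Set (Fin 2 → BondConfig (Site d)))
    (PS PSn QS PE PEn QE : Fin 3 → Site d → Site d → ℝ≥0∞) (Ab Am : DirBlockFamily d)
    (hPS : ∀ a u w, PS a u w = blockTriv a u w + PSn a u w)
    (hPE : ∀ b s r, PE b s r = blockTriv b s r + PEn b s r)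
    (h1 : Ξx ≤ ∑' b : Site d × Site d, ∑' w : Site d, ∑' z : Site d, ∑' t : Site d,
      ENNReal.ofReal (bondJ d p (b.2 - b.1)) * piPerc d p 2 (E b.1 b.2 w z t))
    (h0 : ∀ (a b : Fin 3) (u v w z t : Site d),
      ENNReal.ofReal (bondJ d p (v - u)) * piPerc d p 2 (E u v w z t ∩ clsSet u w t z a b) ≤
        ∑ ι : Fin d × Bool, (if v = u + stepVec ι then (1 : ℝ≥0∞) else 0) *
          (PS a u w * Ab ι a b u w t z * PE b (t - x) (z - x)))
    (h01 : ∀ (a b : Fin 3) (u v w z t : Site d),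
      ENNReal.ofReal (bondJ d p (v - u)) * piPerc d p 2 (E u v w z t ∩ clsSet u w t z a b) ≤
        ∑ ι : Fin d × Bool, (if v = u + stepVec ι then (1 : ℝ≥0∞) else 0) *
          (PS a u w * Am ι a b u w t z * QE b (t - x) (z - x)))
    (h02 : ∀ (a b : Fin 3) (u v w z t : Site d),
      ENNReal.ofReal (bondJ d p (v - u)) * piPerc d p 2 (E u v w z t ∩ clsSet u w t z a b) ≤
        ∑ ι : Fin d × Bool, (if v = u + stepVec ι then (1 : ℝ≥0∞) else 0) *
          (QS a u w * Am ι b a t z u w * PE b (t - x) (z - x))) :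
    wt x * Ξx ≤ ∑' u, ∑' w, ∑' t, ∑' z, ∑ ι : Fin d × Bool, ∑ a : Fin 3, ∑ b : Fin 3,
      v1Integrand PSn QS PEn QE Ab Am x ι a b u w t z := by
  refine le_tsum_blocks_of_pointwise (wt x * Ξx)
    (fun u v w z t => wt x * (ENNReal.ofReal (bondJ d p (v - u)) * piPerc d p 2 (E u v w z t)))
    (fun ι a b u w t z => v1Integrand PSn QS PEn QE Ab Am x ι a b u w t z) ?_ ?_
  · calc wt x * Ξx ≤ wt x * ∑' b : Site d × Site d, ∑' w : Site d, ∑' z : Site d, ∑' t : Site d,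
          ENNReal.ofReal (bondJ d p (b.2 - b.1)) * piPerc d p 2 (E b.1 b.2 w z t) := mul_le_mul' le_rfl h1
      _ = _ := by simp only [ENNReal.tsum_mul_left]
  · intro u v w z t
    calc wt x * (ENNReal.ofReal (bondJ d p (v - u)) * piPerc d p 2 (E u v w z t))
        ≤ wt x * (ENNReal.ofReal (bondJ d p (v - u)) * ∑ a, ∑ b, piPerc d p 2 (E u v w z t ∩ clsSet u w t z a b)) :=
          mul_le_mul' le_rfl (mul_le_mul' le_rfl (measure_le_sum_inter_clsSet _ _ u w t z))
      _ = ∑ a, ∑ b, wt x * (ENNReal.ofReal (bondJ d p (v - u)) * piPerc d p 2 (E u v w z t ∩ clsSet u w t z a b)) := by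
          rw [Finset.mul_sum, Finset.mul_sum]
          refine Finset.sum_congr rfl fun a _ => ?_
          rw [Finset.mul_sum, Finset.mul_sum]
      _ ≤ ∑ a, ∑ b, ∑ ι, (if v = u + stepVec ι then (1 : ℝ≥0∞) else 0) *
            v1Integrand PSn QS PEn QE Ab Am x ι a b u w t z :=
          Finset.sum_le_sum fun a _ => Finset.sum_le_sum fun b _ =>
            wt_mul_le_sum_v1Integrand PS PSn QS PE PEn QE Ab Am _ (hPS a u w) (hPE b _ _)
              (h0 a b u v w z t) (h01 a b u v w z t) (h02 a b u v w z t)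

/-! ## E. The summation: the split (6.5) in three shapes (double-open `H`-terms; closed block with a sup-gap weighted flank for the `A^ι`-terms) -/

/-- **VERSION 1** as a function of its vectors and matrices:
`u⃗H u⃗ + 2u⃗H(P⃗^E−u⃗) + 2u⃗A h⃗^E + 2h⃗^S Aᵀ u⃗ + 2(P⃗^S−u⃗)H u⃗ + 3h⃗^S Aᵀ(P⃗^E−u⃗) + 3(P⃗^S−u⃗)H(P⃗^E−u⃗) + 3(P⃗^S−u⃗)A h⃗^E`.
[cite: FitznerVanDerHofstad2017, Lemma 5.1 (lemmapercboundXi1-2) and §6.1 (XiIota-Deltabounds-versions1) (arXiv:1506.07977v2 pp. 50, 60)] -/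
def versionOne (u sn en hS hE : Fin 3 → ℝ≥0∞) (H A AT : Matrix (Fin 3) (Fin 3) ℝ≥0∞) : ℝ≥0∞ :=
  u ᵥ* H ⬝ᵥ u + 2 * (u ᵥ* H ⬝ᵥ en) + 2 * (u ᵥ* A ⬝ᵥ hE) + 2 * (hS ᵥ* AT ⬝ᵥ u) + 2 * (sn ᵥ* H ⬝ᵥ u)
  + 3 * (hS ᵥ* AT ⬝ᵥ en) + 3 * (sn ᵥ* H ⬝ᵥ en) + 3 * (sn ᵥ* A ⬝ᵥ hE)

/-- The block triple sum `Σ_x Σ_{u,w,t,z} Σ_{ι,a,b} L^a(u,w) M^{ι,a,b}(u,w,t,z) E^b(t−x,z−x)` of one term of (6.4).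
[cite: FitznerVanDerHofstad2017, §6.1 (6.4)–(6.5) (arXiv:1506.07977v2 p. 58)] -/
def blkTsum (L : Fin 3 → Site d → Site d → ℝ≥0∞) (M : DirBlockFamily d) (E : Fin 3 → Site d → Site d → ℝ≥0∞) :
    ℝ≥0∞ :=
  ∑' x, ∑' u, ∑' w, ∑' t, ∑' z, ∑ ι : Fin d × Bool, ∑ a : Fin 3, ∑ b : Fin 3,
    L a u w * M ι a b u w t z * E b (t - x) (z - x)

/-- The sum of the VERSION-1 integrand splits into its eight block triple sums. [cite: FitznerVanDerHofstad2017, §6.1 (XiIota-Deltabounds-versions1) (arXiv:1506.07977v2 p. 60)] -/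
theorem tsum_v1Integrand_eq (PSn QS PEn QE : Fin 3 → Site d → Site d → ℝ≥0∞) (Ab Am : DirBlockFamily d) :
    ∑' x, ∑' u, ∑' w, ∑' t, ∑' z, ∑ ι : Fin d × Bool, ∑ a : Fin 3, ∑ b : Fin 3,
        v1Integrand PSn QS PEn QE Ab Am x ι a b u w t z =
      blkTsum blockTriv (wtMid Ab) blockTriv + 2 * blkTsum blockTriv (wtMid Ab) PEn
        + 2 * blkTsum blockTriv Am (wtSnd QE) + 2 * blkTsum (wtSnd QS) (revT Am) blockTriv
        + 2 * blkTsum PSn (wtMid Ab) blockTriv + 3 * blkTsum (wtSnd QS) (revT Am) PEn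
        + 3 * blkTsum PSn (wtMid Ab) PEn + 3 * blkTsum PSn Am (wtSnd QE) := by
  simp only [blkTsum, v1Integrand, ENNReal.tsum_add, Finset.sum_add_distrib, ENNReal.tsum_mul_left, ← Finset.mul_sum]

/-- One split (6.5) with the `x`-space bound an identity: `Σ_x Σ_{u,w,t,z} Σ_{ι,a,b} L·M·E ≤ L⃗ ᵥ* (M) ⬝ᵥ E⃗`
(supremum norm). [cite: FitznerVanDerHofstad2017, §6.1 (6.5) (arXiv:1506.07977v2 p. 58)] -/
theorem blkTsum_le_vecP_matAbar_vecP {M : DirBlockFamily d} (hM : ∀ ι a b, IsTransInv (M ι a b))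
    (L E : Fin 3 → Site d → Site d → ℝ≥0∞) : blkTsum L M E ≤ vecP L ᵥ* matAbar M ⬝ᵥ vecP E := by
  unfold blkTsum
  rw [← sum_sum_mul_mul_eq_vecMul_dotProduct]
  exact tsum_le_of_xSpaceBound' hM _ L E fun x => le_rfl

/-- One split (6.5) with the AVERAGED element (the classes selected by `avg` have their gaps averaged over `U`),
under the support and flank-constancy hypotheses of `BlockSummationAvg.tsum_le_of_xSpaceBound_avg'`.
[cite: FitznerVanDerHofstad2017, §6.1 (6.5) (arXiv:1506.07977v2 p. 58) with p. 59 "we include the information that … are neighbors"] -/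
theorem blkTsum_le_vecP_matAbarAvg_vecP (U : Finset (Site d)) (avg : Fin 3 → Bool) {M : DirBlockFamily d}
    (hM : ∀ ι a b, IsTransInv (M ι a b))
    (hMin : ∀ ι a b, avg a = true → ∀ v x y, v ∉ U → M ι a b 0 v x y = 0)
    (hMout : ∀ ι a b, avg b = true → ∀ v x y, y - x ∉ U → M ι a b 0 v x y = 0)
    (L E : Fin 3 → Site d → Site d → ℝ≥0∞) (hL : ∀ a, avg a = true → IsConstOn U (gapSum (L a)))
    (hE : ∀ b, avg b = true → IsConstOn U (gapSum (E b))) :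
    blkTsum L M E ≤ vecP L ᵥ* matAbarAvg U avg M ⬝ᵥ vecP E := by
  unfold blkTsum
  exact tsum_le_vecMul_matAbarAvg_dotProduct' U avg hM hMin hMout _ L E hL hE fun x => le_rfl

/-- `Σ_y Σ_s M(0,h,s,s+y) ≤ sup_v Σ_{x,y} M(0,v,x,y)`: summing the open gap closes the block. (summation step of the transfer). [cite: FitznerVanDerHofstad2017, §6.1 (6.5) and Lemma 5.3 — the `x`-space → matrix-element transfer `Σ ≤ sup` (arXiv:1506.07977v2 pp. 49, 60)] -/
theorem tsum_openGap_le_normB (M : Site d → Site d → Site d → Site d → ℝ≥0∞) (h : Site d) :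
    ∑' y, openGap M h y ≤ normB M := by
  unfold openGap normB
  calc ∑' y, ∑' s, M 0 h s (s + y) = ∑' s, ∑' y, M 0 h s (s + y) := ENNReal.tsum_comm
    _ = ∑' s, ∑' y, M 0 h s y := tsum_congr fun s => tsum_add_left_eq (fun y => M 0 h s y) s
    _ ≤ ⨆ v, ∑' x, ∑' y, M 0 v x y := le_iSup (fun v => ∑' x, ∑' y, M 0 v x y) h

/-- **The split (6.5) with a sup-gap EXIT flank** (the shape of the terms `u⃗ A^ι h⃗^E`, `(P⃗^S−u⃗) A^ι h⃗^E` of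
VERSION 1): for a translation-invariant block `M`,
`Σ_x Σ_{u,w,t,z} L(u,w) M(u,w,t,z) R(t−x,z−x) ≤ λ(L) · sup_v Σ_{x,y} M(0,v,x,y) · sup_y Λ_R(y)`
(full pair sum of the start flank, CLOSED norm of the block, sup-gap of the exit flank).
[cite: FitznerVanDerHofstad2017, §6.1 (6.5) (arXiv:1506.07977v2 p. 58) and (XiIota-Deltabounds-versions1) with "We have defined the diagrams in h^S, h^E and H^(3) as the bound on the weighted version of Q^S, Q^E and Ā^ι" (p. 60)] -/
theorem junction_le_pairSum_normB_supGap (L : Site d → Site d → ℝ≥0∞) {M : Site d → Site d → Site d → Site d → ℝ≥0∞}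
    (hM : IsTransInv M) (R : Site d → Site d → ℝ≥0∞) :
    ∑' x, ∑' u, ∑' w, ∑' t, ∑' z, L u w * M u w t z * R (t - x) (z - x) ≤ pairSum L * normB M * supGap R := by
  rw [junction_eq_gapSum L hM R]
  calc ∑' h, ∑' y, gapSum L h * (openGap M h y * gapSum R y)
      ≤ ∑' h, ∑' y, gapSum L h * (openGap M h y * supGap R) :=
        ENNReal.tsum_le_tsum fun h => ENNReal.tsum_le_tsum fun y =>
          mul_le_mul' le_rfl (mul_le_mul' le_rfl (gapSum_le_supGap R y))
    _ = ∑' h, gapSum L h * ((∑' y, openGap M h y) * supGap R) := by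
        refine tsum_congr fun h => ?_
        rw [ENNReal.tsum_mul_left, ENNReal.tsum_mul_right]
    _ ≤ ∑' h, gapSum L h * (normB M * supGap R) :=
        ENNReal.tsum_le_tsum fun h => mul_le_mul' le_rfl (mul_le_mul' (tsum_openGap_le_normB M h) le_rfl)
    _ = pairSum L * normB M * supGap R := by
        rw [ENNReal.tsum_mul_right, ← pairSum_eq_tsum_gapSum, mul_assoc]

/-- Reversing a translation-invariant block keeps it translation invariant. (pointwise property of the reversal). [cite: FitznerVanDerHofstad2017, §6.1 (lemmapercboundXi1-1-step0.3) — the reversed middle block of (step0.2) (arXiv:1506.07977v2 p. 59)] -/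
theorem isTransInv_rev {A : Site d → Site d → Site d → Site d → ℝ≥0∞} (hA : IsTransInv A) :
    IsTransInv (fun u w t z => A t z u w) := fun g u w t z => hA g t z u w

/-- For the REVERSED block `(u,w,t,z) ↦ A(t,z,u,w)`: summing its in-gap at fixed out-gap `y` gives the closed norm
of `A` at in-gap `y` — `Σ_h Σ_s A(s,s+y,0,h) = Σ_{x,y'} A(0,y,x,y') ≤ sup_v Σ_{x,y'} A(0,v,x,y')`
(translate by `−s`, reflect `s ↦ −s`). (summation step of the transfer for the reversed block). [cite: FitznerVanDerHofstad2017, §6.1 (lemmapercboundXi1-1-step0.3) — the reversed middle block of (step0.2) (arXiv:1506.07977v2 p. 59)] -/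
theorem tsum_openGap_rev_le_normB {A : Site d → Site d → Site d → Site d → ℝ≥0∞} (hA : IsTransInv A) (y : Site d) :
    ∑' h, openGap (fun u w t z => A t z u w) h y ≤ normB A := by
  unfold openGap normB
  have key : ∀ h s : Site d, A s (s + y) 0 h = A 0 y (-s) (h - s) := by
    intro h s
    have e := hA s 0 y (-s) (h - s)
    simp only [zero_add, neg_add_cancel, sub_add_cancel] at e
    rw [add_comm s y]
    exact e
  calc ∑' h, ∑' s, A s (s + y) 0 h = ∑' h, ∑' s, A 0 y (-s) (h - s) := by simp only [key]
    _ = ∑' s, ∑' h, A 0 y (-s) (h - s) := ENNReal.tsum_comm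
    _ = ∑' s, ∑' h, A 0 y (-s) h := tsum_congr fun s => tsum_sub_right_eq (fun h => A 0 y (-s) h) s
    _ = ∑' x, ∑' h, A 0 y x h := by
        simpa using (Equiv.neg (Site d)).tsum_eq (fun x => ∑' h, A 0 y x h)
    _ ≤ ⨆ v, ∑' x, ∑' y', A 0 v x y' := le_iSup (fun v => ∑' x, ∑' y', A 0 v x y') y

/-- **The split (6.5) with a sup-gap START flank and the block entered from its exit pair** (the shape of the terms
`h⃗^S (A^ι)ᵀ u⃗`, `h⃗^S (A^ι)ᵀ (P⃗^E−u⃗)` of VERSION 1, printed `Q^{S,a}(u,w) A^{ι,b,a}(t,z,u,w) P^{E,b}(t−x,z−x)`):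
for a translation-invariant block `A`,
`Σ_x Σ_{u,w,t,z} L(u,w) A(t,z,u,w) R(t−x,z−x) ≤ sup_y Λ_L(y) · sup_v Σ_{x,y} A(0,v,x,y) · λ(R)`
— this is where the transposed CLOSED matrix `({\bf A}^ι)ᵀ` comes from.
[cite: FitznerVanDerHofstad2017, §6.1 (lemmapercboundXi1-1-step0.2)–(lemmapercboundXi1-1-step0.3) and (XiIota-Deltabounds-versions1) (arXiv:1506.07977v2 pp. 59–60); Lemma 5.1 (lemmapercboundXi1-2), the factor `(A^ι)ᵀ` (p. 50)] -/
theorem junction_rev_le_supGap_normB_pairSum (L : Site d → Site d → ℝ≥0∞)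
    {A : Site d → Site d → Site d → Site d → ℝ≥0∞} (hA : IsTransInv A) (R : Site d → Site d → ℝ≥0∞) :
    ∑' x, ∑' u, ∑' w, ∑' t, ∑' z, L u w * A t z u w * R (t - x) (z - x) ≤ supGap L * normB A * pairSum R := by
  have hM : IsTransInv (fun u w t z => A t z u w) := isTransInv_rev hA
  calc ∑' x, ∑' u, ∑' w, ∑' t, ∑' z, L u w * A t z u w * R (t - x) (z - x)
      = ∑' h, ∑' y, gapSum L h * (openGap (fun u w t z => A t z u w) h y * gapSum R y) :=
        junction_eq_gapSum L hM R
    _ ≤ ∑' h, ∑' y, supGap L * (openGap (fun u w t z => A t z u w) h y * gapSum R y) :=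
        ENNReal.tsum_le_tsum fun h => ENNReal.tsum_le_tsum fun y => mul_le_mul' (gapSum_le_supGap L h) le_rfl
    _ = supGap L * ∑' y, (∑' h, openGap (fun u w t z => A t z u w) h y) * gapSum R y := by
        simp only [ENNReal.tsum_mul_left]
        congr 1
        rw [ENNReal.tsum_comm]
        exact tsum_congr fun y => ENNReal.tsum_mul_right
    _ ≤ supGap L * ∑' y, normB A * gapSum R y :=
        mul_le_mul' le_rfl (ENNReal.tsum_le_tsum fun y => mul_le_mul' (tsum_openGap_rev_le_normB hA y) le_rfl)
    _ = supGap L * normB A * pairSum R := by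
        rw [ENNReal.tsum_mul_left, ← pairSum_eq_tsum_gapSum, mul_assoc]

/-- The class-indexed form of `junction_le_pairSum_normB_supGap`:
`Σ_x Σ_{u,w,t,z} Σ_{ι,a,b} L·M·E ≤ L⃗ ᵥ* ({\bf M}) ⬝ᵥ h⃗(E)` with the CLOSED matrix `matB M` and the sup-gap exit
vector `vecH E`. [cite: FitznerVanDerHofstad2017, §6.1 (XiIota-Deltabounds-versions1), terms `u⃗ A^ι h⃗^E`, `(P⃗^S−u⃗) A^ι h⃗^E` (arXiv:1506.07977v2 p. 60)] -/
theorem blkTsum_le_vecP_matB_vecH {M : DirBlockFamily d} (hM : ∀ ι a b, IsTransInv (M ι a b))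
    (L E : Fin 3 → Site d → Site d → ℝ≥0∞) : blkTsum L M E ≤ vecP L ᵥ* matB M ⬝ᵥ vecH E := by
  unfold blkTsum
  rw [← sum_sum_mul_mul_eq_vecMul_dotProduct]
  calc ∑' x, ∑' u, ∑' w, ∑' t, ∑' z, ∑ ι : Fin d × Bool, ∑ a : Fin 3, ∑ b : Fin 3,
          L a u w * M ι a b u w t z * E b (t - x) (z - x)
      = ∑' x, ∑' u, ∑' w, ∑' t, ∑' z, ∑ a : Fin 3, ∑ b : Fin 3,
          L a u w * (∑ ι : Fin d × Bool, M ι a b u w t z) * E b (t - x) (z - x) := by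
        simp only [sum_sum_sum_mul_mul]
    _ = ∑ a : Fin 3, ∑ b : Fin 3, ∑' x, ∑' u, ∑' w, ∑' t, ∑' z,
          L a u w * (∑ ι : Fin d × Bool, M ι a b u w t z) * E b (t - x) (z - x) := by
        simp only [tsum_finsetSum]
    _ ≤ ∑ a : Fin 3, ∑ b : Fin 3, vecP L a * matB M a b * vecH E b :=
        Finset.sum_le_sum fun a _ => Finset.sum_le_sum fun b _ =>
          junction_le_pairSum_normB_supGap (L a) (IsTransInv.finsetSum Finset.univ fun ι _ => hM ι a b) (E b)

/-- The class-indexed form of `junction_rev_le_supGap_normB_pairSum` for the reversed-transposed family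
`revT A` (`(revT A)^{ι,a,b}(u,w,t,z) = A^{ι,b,a}(t,z,u,w)`):
`Σ_x Σ_{u,w,t,z} Σ_{ι,a,b} L^a(u,w) A^{ι,b,a}(t,z,u,w) E^b(t−x,z−x) ≤ h⃗(L) ᵥ* ({\bf A})ᵀ ⬝ᵥ E⃗`.
[cite: FitznerVanDerHofstad2017, §6.1 (XiIota-Deltabounds-versions1), terms `h⃗^S (A^ι)ᵀ u⃗`, `h⃗^S (A^ι)ᵀ (P⃗^E−u⃗)` (arXiv:1506.07977v2 p. 60); Lemma 5.1 (p. 50)] -/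
theorem blkTsum_revT_le_vecH_matBT_vecP {A : DirBlockFamily d} (hA : ∀ ι a b, IsTransInv (A ι a b))
    (L E : Fin 3 → Site d → Site d → ℝ≥0∞) : blkTsum L (revT A) E ≤ vecH L ᵥ* (matB A)ᵀ ⬝ᵥ vecP E := by
  unfold blkTsum revT
  rw [← sum_sum_mul_mul_eq_vecMul_dotProduct]
  calc ∑' x, ∑' u, ∑' w, ∑' t, ∑' z, ∑ ι : Fin d × Bool, ∑ a : Fin 3, ∑ b : Fin 3,
          L a u w * A ι b a t z u w * E b (t - x) (z - x)
      = ∑' x, ∑' u, ∑' w, ∑' t, ∑' z, ∑ a : Fin 3, ∑ b : Fin 3,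
          L a u w * (∑ ι : Fin d × Bool, A ι b a t z u w) * E b (t - x) (z - x) := by
        simp only [sum_sum_sum_mul_mul]
    _ = ∑ a : Fin 3, ∑ b : Fin 3, ∑' x, ∑' u, ∑' w, ∑' t, ∑' z,
          L a u w * (∑ ι : Fin d × Bool, A ι b a t z u w) * E b (t - x) (z - x) := by
        simp only [tsum_finsetSum]
    _ ≤ ∑ a : Fin 3, ∑ b : Fin 3, vecH L a * (matB A)ᵀ a b * vecP E b :=
        Finset.sum_le_sum fun a _ => Finset.sum_le_sum fun b _ =>
          junction_rev_le_supGap_normB_pairSum (L a) (A := fun u v x y => ∑ ι : Fin d × Bool, A ι b a u v x y)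
            (IsTransInv.finsetSum Finset.univ fun ι _ => hA ι b a) (E b)

/-- From the eight block bounds to `versionOne` (monotonicity bookkeeping). [folklore] -/
private theorem eight_le_versionOne {S₁ S₂ S₃ S₄ S₅ S₆ S₇ S₈ : ℝ≥0∞} {u sn en hS hE : Fin 3 → ℝ≥0∞}
    {H A AT : Matrix (Fin 3) (Fin 3) ℝ≥0∞} (h₁ : S₁ ≤ u ᵥ* H ⬝ᵥ u) (h₂ : S₂ ≤ u ᵥ* H ⬝ᵥ en)
    (h₃ : S₃ ≤ u ᵥ* A ⬝ᵥ hE) (h₄ : S₄ ≤ hS ᵥ* AT ⬝ᵥ u) (h₅ : S₅ ≤ sn ᵥ* H ⬝ᵥ u) (h₆ : S₆ ≤ hS ᵥ* AT ⬝ᵥ en)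
    (h₇ : S₇ ≤ sn ᵥ* H ⬝ᵥ en) (h₈ : S₈ ≤ sn ᵥ* A ⬝ᵥ hE) :
    S₁ + 2 * S₂ + 2 * S₃ + 2 * S₄ + 2 * S₅ + 3 * S₆ + 3 * S₇ + 3 * S₈ ≤ versionOne u sn en hS hE H A AT := by
  unfold versionOne
  gcongr

/-- **[FvdH17] Lemma 5.1 (lemmapercboundXi1-2), VERSION 1, abstract form — PROVED bookkeeping.**  If
`‖x‖₂² Ξ(x) ≤ Σ_{u,w,t,z} Σ_{ι,a,b} V₁(x;…)` for every `x` (part D), with translation-invariant `Ā`, `A`, then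
`Σ_x ‖x‖₂² Ξ(x) ≤ versionOne u⃗ (P⃗^S−u⃗) (P⃗^E−u⃗) h⃗^S h⃗^E H A Aᵀ` with `u⃗ = vecP blockTriv`, `P⃗^S−u⃗ = vecP P^S_n`,
`P⃗^E−u⃗ = vecP P^E_n` (full pair sums), `h⃗^S = vecH (wtSnd Q^S)`, `h⃗^E = vecH (wtSnd Q^E)` (sup-gap functionals
of the weighted flanks: `(h⃗)_b = sup_y Σ_s ‖s+y‖₂² Q^b(s,s+y)`), `H = matAbar (wtMid Ā)` (double-open supremum norm),
`A = matB A^ι`, `Aᵀ = (matB A^ι)ᵀ` (the CLOSED norm `({\bf A}^ι)_{a,b} = sup_v Σ_{ι,x,y} A^{ι,a,b}(0,v,x,y)` of §5.1).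
[cite: FitznerVanDerHofstad2017, Lemma 5.1 (lemmapercboundXi1-2) (arXiv:1506.07977v2 p. 50); proof §6.1 (XiIota-Deltabounds-versions1) (p. 60)] -/
theorem tsum_wt_mul_le_versionOne (Ξ : Site d → ℝ≥0∞) (PSn QS PEn QE : Fin 3 → Site d → Site d → ℝ≥0∞)
    {Ab Am : DirBlockFamily d} (hAb : ∀ ι a b, IsTransInv (Ab ι a b)) (hAm : ∀ ι a b, IsTransInv (Am ι a b))
    (hΞ : ∀ x, wt x * Ξ x ≤ ∑' u, ∑' w, ∑' t, ∑' z, ∑ ι : Fin d × Bool, ∑ a : Fin 3, ∑ b : Fin 3,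
      v1Integrand PSn QS PEn QE Ab Am x ι a b u w t z) :
    ∑' x, wt x * Ξ x ≤ versionOne (vecP (blockTriv (d := d))) (vecP PSn) (vecP PEn) (vecH (wtSnd QS))
      (vecH (wtSnd QE)) (matAbar (wtMid Ab)) (matB Am) (matB Am)ᵀ := by
  have hH : ∀ ι a b, IsTransInv (wtMid Ab ι a b) := isTransInv_wtMid hAb
  calc ∑' x, wt x * Ξ x
      ≤ ∑' x, ∑' u, ∑' w, ∑' t, ∑' z, ∑ ι : Fin d × Bool, ∑ a : Fin 3, ∑ b : Fin 3,
          v1Integrand PSn QS PEn QE Ab Am x ι a b u w t z := ENNReal.tsum_le_tsum hΞ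
    _ = _ := tsum_v1Integrand_eq PSn QS PEn QE Ab Am
    _ ≤ _ := eight_le_versionOne (blkTsum_le_vecP_matAbar_vecP hH _ _) (blkTsum_le_vecP_matAbar_vecP hH _ _)
        (blkTsum_le_vecP_matB_vecH hAm _ _) (blkTsum_revT_le_vecH_matBT_vecP hAm _ _)
        (blkTsum_le_vecP_matAbar_vecP hH _ _) (blkTsum_revT_le_vecH_matBT_vecP hAm _ _)
        (blkTsum_le_vecP_matAbar_vecP hH _ _) (blkTsum_le_vecP_matB_vecH hAm _ _)

/-! ## E′. The same with the averaged element on the `Ā`-terms -/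

/-- The gap aggregate of the trivial piece vanishes at every non-zero offset. (evaluation of the Kronecker deltas of the trivial piece). [cite: FitznerVanDerHofstad2017, §6.1 proof of Lemma 5.1, sentence before (XiIota-Deltabounds-versions1) — the trivial triangle `u⃗ᵀ = (1,0,0)` split off `P^{S,0}`/`P^{E,0}` (arXiv:1506.07977v2 p. 60)] -/
theorem gapSum_blockTriv_of_ne_zero (a : Fin 3) {v : Site d} (hv : v ≠ 0) : gapSum (blockTriv (d := d) a) v = 0 := by
  unfold gapSum
  refine ENNReal.tsum_eq_zero.2 fun s => ?_
  unfold blockTriv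
  rw [if_neg]
  rintro ⟨-, hs, hsv⟩
  exact hv (by simpa [hs] using hsv)

/-- The trivial piece has gap aggregates constant (`= 0`) on any offset set missing `0`. (evaluation of the Kronecker deltas of the trivial piece). [cite: FitznerVanDerHofstad2017, §6.1 proof of Lemma 5.1, sentence before (XiIota-Deltabounds-versions1) — the trivial triangle `u⃗ᵀ = (1,0,0)` split off `P^{S,0}`/`P^{E,0}` (arXiv:1506.07977v2 p. 60)] -/
theorem isConstOn_gapSum_blockTriv {U : Finset (Site d)} (h0 : (0 : Site d) ∉ U) (a : Fin 3) :
    IsConstOn U (gapSum (blockTriv (d := d) a)) := by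
  intro v hv v' hv'
  rw [gapSum_blockTriv_of_ne_zero a (fun h => h0 (h ▸ hv)), gapSum_blockTriv_of_ne_zero a (fun h => h0 (h ▸ hv'))]

/-- Removing the trivial piece does not change the gap aggregates at non-zero offsets. (evaluation of the Kronecker deltas of the trivial piece). [cite: FitznerVanDerHofstad2017, §6.1 proof of Lemma 5.1, sentence before (XiIota-Deltabounds-versions1) — the trivial triangle `u⃗ᵀ = (1,0,0)` split off `P^{S,0}`/`P^{E,0}` (arXiv:1506.07977v2 p. 60)] -/
theorem gapSum_eq_of_eq_blockTriv_add {P Pn : Fin 3 → Site d → Site d → ℝ≥0∞} {a : Fin 3}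
    (h : ∀ x y, P a x y = blockTriv a x y + Pn a x y) {v : Site d} (hv : v ≠ 0) :
    gapSum (Pn a) v = gapSum (P a) v := by
  have h' : gapSum (P a) v = gapSum (blockTriv a) v + gapSum (Pn a) v := by
    unfold gapSum; rw [← ENNReal.tsum_add]; exact tsum_congr fun s => h s (s + v)
  rw [h', gapSum_blockTriv_of_ne_zero a hv, zero_add]

/-- Flank constancy passes from `P` to `P − triv` on any offset set missing `0`. (evaluation of the Kronecker deltas of the trivial piece). [cite: FitznerVanDerHofstad2017, §6.1 proof of Lemma 5.1, sentence before (XiIota-Deltabounds-versions1) — the trivial triangle `u⃗ᵀ = (1,0,0)` split off `P^{S,0}`/`P^{E,0}` (arXiv:1506.07977v2 p. 60)] -/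
theorem isConstOn_gapSum_of_eq_blockTriv_add {U : Finset (Site d)} (h0 : (0 : Site d) ∉ U)
    {P Pn : Fin 3 → Site d → Site d → ℝ≥0∞} {a : Fin 3} (h : ∀ x y, P a x y = blockTriv a x y + Pn a x y)
    (hP : IsConstOn U (gapSum (P a))) : IsConstOn U (gapSum (Pn a)) := by
  intro v hv v' hv'
  rw [gapSum_eq_of_eq_blockTriv_add h (fun e => h0 (e ▸ hv)), gapSum_eq_of_eq_blockTriv_add h (fun e => h0 (e ▸ hv'))]
  exact hP hv hv'

/-- The support hypotheses pass from `Ā` to its weighting `wtMid Ā`. (pointwise property of the weighting `‖x−y‖₂² Ā`). [cite: FitznerVanDerHofstad2017, App. B "Building blocks with weight", H^{(3)} (arXiv:1506.07977v2 p. 78); §6.1 (lemmapercboundXi1-1-step0.2) (p. 59)] -/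
theorem wtMid_eq_zero_of {Ab : DirBlockFamily d} {ι : Fin d × Bool} {a b : Fin 3} {u v x y : Site d}
    (h : Ab ι a b u v x y = 0) : wtMid Ab ι a b u v x y = 0 := by
  unfold wtMid; rw [h, mul_zero]

/-- **VERSION 1 with the averaged `Ā`-element — PROVED bookkeeping.**  As `tsum_wt_mul_le_versionOne`, but the four
`H`-terms are bounded through the AVERAGED double-open matrix `matAbarAvg U avg (wtMid Ā)` (the classes selected by
`avg` — in the application class `1̲`, "u and w are neighbors" — averaged over the offset set `U`, `0 ∉ U`), given:
`Ā` vanishes off in-offsets (out-offsets) in `U` for averaged in-classes (out-classes), and the flanks `P^S`, `P^E`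
(hence `P^S − triv`, `P^E − triv` and `triv`) have gap aggregates constant on `U` for averaged classes.
[cite: FitznerVanDerHofstad2017, Lemma 5.1 (lemmapercboundXi1-2) (arXiv:1506.07977v2 p. 50); §6.1 p. 59 "we include the information that … are neighbors"; (XiIota-Deltabounds-versions1) (p. 60)] -/
theorem tsum_wt_mul_le_versionOne_avg (U : Finset (Site d)) (h0 : (0 : Site d) ∉ U) (avg : Fin 3 → Bool)
    (Ξ : Site d → ℝ≥0∞) (PS PSn QS PE PEn QE : Fin 3 → Site d → Site d → ℝ≥0∞) {Ab Am : DirBlockFamily d}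
    (hAb : ∀ ι a b, IsTransInv (Ab ι a b)) (hAm : ∀ ι a b, IsTransInv (Am ι a b))
    (hAin : ∀ ι a b, avg a = true → ∀ v x y, v ∉ U → Ab ι a b 0 v x y = 0)
    (hAout : ∀ ι a b, avg b = true → ∀ v x y, y - x ∉ U → Ab ι a b 0 v x y = 0)
    (hPS : ∀ a x y, PS a x y = blockTriv a x y + PSn a x y) (hPE : ∀ b x y, PE b x y = blockTriv b x y + PEn b x y)
    (hS : ∀ a, avg a = true → IsConstOn U (gapSum (PS a))) (hE : ∀ b, avg b = true → IsConstOn U (gapSum (PE b)))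
    (hΞ : ∀ x, wt x * Ξ x ≤ ∑' u, ∑' w, ∑' t, ∑' z, ∑ ι : Fin d × Bool, ∑ a : Fin 3, ∑ b : Fin 3,
      v1Integrand PSn QS PEn QE Ab Am x ι a b u w t z) :
    ∑' x, wt x * Ξ x ≤ versionOne (vecP (blockTriv (d := d))) (vecP PSn) (vecP PEn) (vecH (wtSnd QS))
      (vecH (wtSnd QE)) (matAbarAvg U avg (wtMid Ab)) (matB Am) (matB Am)ᵀ := by
  have hH : ∀ ι a b, IsTransInv (wtMid Ab ι a b) := isTransInv_wtMid hAb
  have hHin : ∀ ι a b, avg a = true → ∀ v x y, v ∉ U → wtMid Ab ι a b 0 v x y = 0 :=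
    fun ι a b ha v x y hv => wtMid_eq_zero_of (hAin ι a b ha v x y hv)
  have hHout : ∀ ι a b, avg b = true → ∀ v x y, y - x ∉ U → wtMid Ab ι a b 0 v x y = 0 :=
    fun ι a b hb v x y hxy => wtMid_eq_zero_of (hAout ι a b hb v x y hxy)
  have hTr : ∀ a, avg a = true → IsConstOn U (gapSum (blockTriv (d := d) a)) := fun a _ => isConstOn_gapSum_blockTriv h0 a
  have hSn : ∀ a, avg a = true → IsConstOn U (gapSum (PSn a)) :=
    fun a ha => isConstOn_gapSum_of_eq_blockTriv_add h0 (hPS a) (hS a ha)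
  have hEn : ∀ b, avg b = true → IsConstOn U (gapSum (PEn b)) :=
    fun b hb => isConstOn_gapSum_of_eq_blockTriv_add h0 (hPE b) (hE b hb)
  calc ∑' x, wt x * Ξ x
      ≤ ∑' x, ∑' u, ∑' w, ∑' t, ∑' z, ∑ ι : Fin d × Bool, ∑ a : Fin 3, ∑ b : Fin 3,
          v1Integrand PSn QS PEn QE Ab Am x ι a b u w t z := ENNReal.tsum_le_tsum hΞ
    _ = _ := tsum_v1Integrand_eq PSn QS PEn QE Ab Am
    _ ≤ _ := eight_le_versionOne (blkTsum_le_vecP_matAbarAvg_vecP U avg hH hHin hHout _ _ hTr hTr)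
        (blkTsum_le_vecP_matAbarAvg_vecP U avg hH hHin hHout _ _ hTr hEn)
        (blkTsum_le_vecP_matB_vecH hAm _ _) (blkTsum_revT_le_vecH_matBT_vecP hAm _ _)
        (blkTsum_le_vecP_matAbarAvg_vecP U avg hH hHin hHout _ _ hSn hTr) (blkTsum_revT_le_vecH_matBT_vecP hAm _ _)
        (blkTsum_le_vecP_matAbarAvg_vecP U avg hH hHin hHout _ _ hSn hEn) (blkTsum_le_vecP_matB_vecH hAm _ _)

/-! ## D″. The `x`-space bound, VERSION 2 raw form -/

/-- **(step0.3) with the `u⃗`-extraction of VERSION 2 (raw), `x`-space form**: as `wt_mul_le_blocks_v1_of_cls`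
with the integrand `v2Integrand` (one-side-trivial configurations unsplit); extra inputs: the non-trivial pieces
vanish on the trivial data (`P^S_n(0,0) = 0`, `P^E_n(·,0) = 0`).
[cite: FitznerVanDerHofstad2017, §6.1 proof of Lemma 5.1 (arXiv:1506.07977v2 pp. 58–60); App. C.1 first paragraph (arXiv:1506.07977v2 p. 79; TeX `AdditionalBoundForLongVersion.tex` l.9–21)] -/
theorem wt_mul_le_blocks_v2_of_cls (p : unitInterval) (x : Site d) (Ξx : ℝ≥0∞)
    (E : Site d → Site d → Site d → Site d → Site d → Set (Fin 2 → BondConfig (Site d)))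
    (PS PSn QS PE PEn QE : Fin 3 → Site d → Site d → ℝ≥0∞) (Ab Am : DirBlockFamily d)
    (hPS : ∀ a u w, PS a u w = blockTriv a u w + PSn a u w)
    (hPE : ∀ b s r, PE b s r = blockTriv b s r + PEn b s r)
    (hSn0 : ∀ a, PSn a 0 0 = 0) (hEn0 : ∀ b s, PEn b s 0 = 0)
    (h1 : Ξx ≤ ∑' b : Site d × Site d, ∑' w : Site d, ∑' z : Site d, ∑' t : Site d,
      ENNReal.ofReal (bondJ d p (b.2 - b.1)) * piPerc d p 2 (E b.1 b.2 w z t))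
    (h0 : ∀ (a b : Fin 3) (u v w z t : Site d),
      ENNReal.ofReal (bondJ d p (v - u)) * piPerc d p 2 (E u v w z t ∩ clsSet u w t z a b) ≤
        ∑ ι : Fin d × Bool, (if v = u + stepVec ι then (1 : ℝ≥0∞) else 0) *
          (PS a u w * Ab ι a b u w t z * PE b (t - x) (z - x)))
    (h01 : ∀ (a b : Fin 3) (u v w z t : Site d),
      ENNReal.ofReal (bondJ d p (v - u)) * piPerc d p 2 (E u v w z t ∩ clsSet u w t z a b) ≤
        ∑ ι : Fin d × Bool, (if v = u + stepVec ι then (1 : ℝ≥0∞) else 0) *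
          (PS a u w * Am ι a b u w t z * QE b (t - x) (z - x)))
    (h02 : ∀ (a b : Fin 3) (u v w z t : Site d),
      ENNReal.ofReal (bondJ d p (v - u)) * piPerc d p 2 (E u v w z t ∩ clsSet u w t z a b) ≤
        ∑ ι : Fin d × Bool, (if v = u + stepVec ι then (1 : ℝ≥0∞) else 0) *
          (QS a u w * Am ι b a t z u w * PE b (t - x) (z - x))) :
    wt x * Ξx ≤ ∑' u, ∑' w, ∑' t, ∑' z, ∑ ι : Fin d × Bool, ∑ a : Fin 3, ∑ b : Fin 3,
      v2Integrand PSn QS PEn QE Ab Am x ι a b u w t z := by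
  refine le_tsum_blocks_of_pointwise (wt x * Ξx)
    (fun u v w z t => wt x * (ENNReal.ofReal (bondJ d p (v - u)) * piPerc d p 2 (E u v w z t)))
    (fun ι a b u w t z => v2Integrand PSn QS PEn QE Ab Am x ι a b u w t z) ?_ ?_
  · calc wt x * Ξx ≤ wt x * ∑' b : Site d × Site d, ∑' w : Site d, ∑' z : Site d, ∑' t : Site d,
          ENNReal.ofReal (bondJ d p (b.2 - b.1)) * piPerc d p 2 (E b.1 b.2 w z t) := mul_le_mul' le_rfl h1
      _ = _ := by simp only [ENNReal.tsum_mul_left]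
  · intro u v w z t
    calc wt x * (ENNReal.ofReal (bondJ d p (v - u)) * piPerc d p 2 (E u v w z t))
        ≤ wt x * (ENNReal.ofReal (bondJ d p (v - u)) * ∑ a, ∑ b, piPerc d p 2 (E u v w z t ∩ clsSet u w t z a b)) :=
          mul_le_mul' le_rfl (mul_le_mul' le_rfl (measure_le_sum_inter_clsSet _ _ u w t z))
      _ = ∑ a, ∑ b, wt x * (ENNReal.ofReal (bondJ d p (v - u)) * piPerc d p 2 (E u v w z t ∩ clsSet u w t z a b)) := by
          rw [Finset.mul_sum, Finset.mul_sum]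
          refine Finset.sum_congr rfl fun a _ => ?_
          rw [Finset.mul_sum, Finset.mul_sum]
      _ ≤ ∑ a, ∑ b, ∑ ι, (if v = u + stepVec ι then (1 : ℝ≥0∞) else 0) *
            v2Integrand PSn QS PEn QE Ab Am x ι a b u w t z :=
          Finset.sum_le_sum fun a _ => Finset.sum_le_sum fun b _ =>
            wt_mul_le_sum_v2Integrand PS PSn QS PE PEn QE Ab Am _ (hPS a u w) (hPE b _ _) (hSn0 a) (hEn0 b _)
              (h0 a b u v w z t) (h01 a b u v w z t) (h02 a b u v w z t)

/-! ## E‴. VERSION 2 in raw form: `u⃗ᵀ H u⃗ + R_R + R_L + 3(…)`, the two one-side-trivial sums carried explicitly -/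

/-- **VERSION 2 (raw)** as a function of its vectors, matrices and the two raw one-side-trivial sums:
`u⃗ H u⃗ + R_R + R_L + 3h⃗^S Aᵀ(P⃗^E−u⃗) + 3(P⃗^S−u⃗)H(P⃗^E−u⃗) + 3(P⃗^S−u⃗)A h⃗^E` — the printed second version of
Lemma 5.1 is this with `R_R + R_L` bounded by the eight App.-C.1 terms.
[cite: FitznerVanDerHofstad2017, Lemma 5.1 (lemmapercboundXi1-2) second version (arXiv:1506.07977v2 p. 50; TeX `Bounds/BoundNOne.tex` l.19–30); App. C.1 (arXiv:1506.07977v2 p. 79; TeX `AdditionalBoundForLongVersion.tex` l.9–70)] -/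
def versionTwoRaw (u sn en hS hE : Fin 3 → ℝ≥0∞) (H A AT : Matrix (Fin 3) (Fin 3) ℝ≥0∞) (RR RL : ℝ≥0∞) : ℝ≥0∞ :=
  u ᵥ* H ⬝ᵥ u + RR + RL + 3 * (hS ᵥ* AT ⬝ᵥ en) + 3 * (sn ᵥ* H ⬝ᵥ en) + 3 * (sn ᵥ* A ⬝ᵥ hE)

/-- **The raw right-trivial sum** `R_R = Σ_x Σ_{u,w,t,z} Σ_{ι,a,b} ‖x‖₂² P^S_n(u,w) Ā^{ι,a,b}(u,w,t,z) triv^b(t−x,z−x)`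
(= `Σ_{ι,a} Σ_{x,u,w} ‖x‖₂² P^S_n(u,w) Ā^{ι,a,0}(u,w,x,x)`, `rawR_eq`): the configurations "right triangle trivial,
`t = z = x`", left non-trivial, of App. C.1 cases a)–d). [cite: FitznerVanDerHofstad2017, App. C.1 (arXiv:1506.07977v2 p. 79; TeX `AdditionalBoundForLongVersion.tex` l.19–66)] -/
def rawR (Sn : Fin 3 → Site d → Site d → ℝ≥0∞) (Ab : DirBlockFamily d) : ℝ≥0∞ :=
  ∑' x, ∑' u, ∑' w, ∑' t, ∑' z, ∑ ι : Fin d × Bool, ∑ a : Fin 3, ∑ b : Fin 3,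
    wt x * (Sn a u w * Ab ι a b u w t z * blockTriv b (t - x) (z - x))

/-- **The raw left-trivial sum** `R_L = Σ_x Σ_{u,w,t,z} Σ_{ι,a,b} ‖x‖₂² triv^a(u,w) Ā^{ι,a,b}(u,w,t,z) P^E_n(t−x,z−x)`
(= `Σ_{ι,b} Σ_{x,t,z} ‖x‖₂² Ā^{ι,0,b}(0,0,t,z) P^E_n(t−x,z−x)`, `rawL_eq`): "if the left triangle is trivial, `u = w = 0`".
[cite: FitznerVanDerHofstad2017, App. C.1 (arXiv:1506.07977v2 p. 79; TeX `AdditionalBoundForLongVersion.tex` l.67–70)] -/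
def rawL (Ab : DirBlockFamily d) (En : Fin 3 → Site d → Site d → ℝ≥0∞) : ℝ≥0∞ :=
  ∑' x, ∑' u, ∑' w, ∑' t, ∑' z, ∑ ι : Fin d × Bool, ∑ a : Fin 3, ∑ b : Fin 3,
    wt x * (blockTriv a u w * Ab ι a b u w t z * En b (t - x) (z - x))

/-- Collapse of an exit sum against the trivial piece: `Σ_{t,z} Σ_b F^b(t,z) triv^b(t−x,z−x) = F^0(x,x)`. (evaluation of the Kronecker deltas of the trivial piece). [cite: FitznerVanDerHofstad2017, §6.1 proof of Lemma 5.1, sentence before (XiIota-Deltabounds-versions1) — the trivial triangle `u⃗ᵀ = (1,0,0)` split off `P^{S,0}`/`P^{E,0}` (arXiv:1506.07977v2 p. 60)] -/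
theorem tsum_tsum_sum_mul_blockTriv (F : Fin 3 → Site d → Site d → ℝ≥0∞) (x : Site d) :
    ∑' t, ∑' z, ∑ b : Fin 3, F b t z * blockTriv b (t - x) (z - x) = F 0 x x := by
  have h1 : ∀ t, t ≠ x → ∑' z, ∑ b : Fin 3, F b t z * blockTriv b (t - x) (z - x) = 0 := fun t ht =>
    ENNReal.tsum_eq_zero.2 fun z => Finset.sum_eq_zero fun b _ => by simp [blockTriv, sub_eq_zero, ht]
  have h2 : ∀ z, z ≠ x → ∑ b : Fin 3, F b x z * blockTriv b (x - x) (z - x) = 0 := fun z hz =>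
    Finset.sum_eq_zero fun b _ => by simp [blockTriv, sub_eq_zero, hz]
  rw [tsum_eq_single x h1, tsum_eq_single x h2,
    Finset.sum_eq_single (0 : Fin 3) (fun b _ hb => by simp [blockTriv, hb]) (fun h => absurd (Finset.mem_univ _) h)]
  simp [blockTriv]

/-- Collapse of a start sum against the trivial piece: `Σ_{u,w} Σ_a triv^a(u,w) F^a(u,w) = F^0(0,0)`. (evaluation of the Kronecker deltas of the trivial piece). [cite: FitznerVanDerHofstad2017, §6.1 proof of Lemma 5.1, sentence before (XiIota-Deltabounds-versions1) — the trivial triangle `u⃗ᵀ = (1,0,0)` split off `P^{S,0}`/`P^{E,0}` (arXiv:1506.07977v2 p. 60)] -/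
theorem tsum_tsum_sum_blockTriv_mul (F : Fin 3 → Site d → Site d → ℝ≥0∞) :
    ∑' u, ∑' w, ∑ a : Fin 3, blockTriv a u w * F a u w = F 0 0 0 := by
  have h1 : ∀ u, u ≠ 0 → ∑' w, ∑ a : Fin 3, blockTriv a u w * F a u w = 0 := fun u hu =>
    ENNReal.tsum_eq_zero.2 fun w => Finset.sum_eq_zero fun a _ => by simp [blockTriv, hu]
  have h2 : ∀ w, w ≠ 0 → ∑ a : Fin 3, blockTriv a 0 w * F a 0 w = 0 := fun w hw =>
    Finset.sum_eq_zero fun a _ => by simp [blockTriv, hw]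
  rw [tsum_eq_single 0 h1, tsum_eq_single 0 h2,
    Finset.sum_eq_single (0 : Fin 3) (fun a _ ha => by simp [blockTriv, ha]) (fun h => absurd (Finset.mem_univ _) h)]
  simp [blockTriv]

/-- **`R_R` collapsed**: `R_R = Σ_x Σ_{u,w} Σ_{ι,a} ‖x‖₂² P^S_n(u,w) Ā^{ι,a,0}(u,w,x,x)` — the diagram
`Σ ‖x‖₂² P^{S,a}(u,w) Ā^{ι,a,0}(u,w,x,x)` of App. C.1. [cite: FitznerVanDerHofstad2017, App. C.1 (arXiv:1506.07977v2 p. 79; TeX `AdditionalBoundForLongVersion.tex` l.19–21)] -/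
theorem rawR_eq (Sn : Fin 3 → Site d → Site d → ℝ≥0∞) (Ab : DirBlockFamily d) :
    rawR Sn Ab = ∑' x, ∑' u, ∑' w, ∑ ι : Fin d × Bool, ∑ a : Fin 3, wt x * (Sn a u w * Ab ι a 0 u w x x) := by
  unfold rawR
  refine tsum_congr fun x => tsum_congr fun u => tsum_congr fun w => ?_
  have hre : ∀ t z, ∑ ι : Fin d × Bool, ∑ a : Fin 3, ∑ b : Fin 3,
      wt x * (Sn a u w * Ab ι a b u w t z * blockTriv b (t - x) (z - x))
      = ∑ b : Fin 3, (∑ ι : Fin d × Bool, ∑ a : Fin 3, wt x * (Sn a u w * Ab ι a b u w t z))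
        * blockTriv b (t - x) (z - x) := by
    intro t z
    calc ∑ ι : Fin d × Bool, ∑ a : Fin 3, ∑ b : Fin 3, wt x * (Sn a u w * Ab ι a b u w t z * blockTriv b (t - x) (z - x))
        = ∑ ι : Fin d × Bool, ∑ b : Fin 3, ∑ a : Fin 3, wt x * (Sn a u w * Ab ι a b u w t z * blockTriv b (t - x) (z - x)) :=
          Finset.sum_congr rfl fun ι _ => Finset.sum_comm
      _ = ∑ b : Fin 3, ∑ ι : Fin d × Bool, ∑ a : Fin 3, wt x * (Sn a u w * Ab ι a b u w t z * blockTriv b (t - x) (z - x)) :=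
          Finset.sum_comm
      _ = _ := Finset.sum_congr rfl fun b _ => by
          rw [Finset.sum_mul]
          refine Finset.sum_congr rfl fun ι _ => ?_
          rw [Finset.sum_mul]
          exact Finset.sum_congr rfl fun a _ => by ring
  simp only [hre]
  exact tsum_tsum_sum_mul_blockTriv (fun b t z => ∑ ι : Fin d × Bool, ∑ a : Fin 3, wt x * (Sn a u w * Ab ι a b u w t z)) x

/-- **`R_L` collapsed**: `R_L = Σ_x Σ_{t,z} Σ_{ι,b} ‖x‖₂² Ā^{ι,0,b}(0,0,t,z) P^E_n(t−x,z−x)`.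
[cite: FitznerVanDerHofstad2017, App. C.1 (arXiv:1506.07977v2 p. 79; TeX `AdditionalBoundForLongVersion.tex` l.67–70)] -/
theorem rawL_eq (Ab : DirBlockFamily d) (En : Fin 3 → Site d → Site d → ℝ≥0∞) :
    rawL Ab En = ∑' x, ∑' t, ∑' z, ∑ ι : Fin d × Bool, ∑ b : Fin 3, wt x * (Ab ι 0 b 0 0 t z * En b (t - x) (z - x)) := by
  unfold rawL
  refine tsum_congr fun x => ?_
  rw [tsum_rot₄, tsum_rot₄]
  refine tsum_congr fun t => tsum_congr fun z => ?_
  have hre : ∀ u w, ∑ ι : Fin d × Bool, ∑ a : Fin 3, ∑ b : Fin 3,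
      wt x * (blockTriv a u w * Ab ι a b u w t z * En b (t - x) (z - x))
      = ∑ a : Fin 3, blockTriv a u w * ∑ ι : Fin d × Bool, ∑ b : Fin 3, wt x * (Ab ι a b u w t z * En b (t - x) (z - x)) := by
    intro u w
    rw [Finset.sum_comm]
    refine Finset.sum_congr rfl fun a _ => ?_
    rw [Finset.mul_sum]
    refine Finset.sum_congr rfl fun ι _ => ?_
    rw [Finset.mul_sum]
    exact Finset.sum_congr rfl fun b _ => by ring
  simp only [hre]
  exact tsum_tsum_sum_blockTriv_mul (fun a u w => ∑ ι : Fin d × Bool, ∑ b : Fin 3, wt x * (Ab ι a b u w t z * En b (t - x) (z - x)))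

/-- **The `(ι,a)` piece of `R_R`** after the exit collapse of `rawR_eq`:
`R_R(ι,a) := Σ_{x,u,w} ‖x‖₂² (P^S − u⃗)_a(u,w) · Ā^{ι,a,0}(u,w,x,x)` — the entry diagram of App. C.1 with the start
triangle of class `a` and the exit triangle trivial (`z = x`), weight `‖x‖₂²` carried unsplit.
[cite: FitznerVanDerHofstad2017, App. C.1 (arXiv:1506.07977v2 p. 79; TeX AdditionalBoundForLongVersion.tex l.9–21)] -/
def rawRPiece (Sn : Fin 3 → Site d → Site d → ℝ≥0∞) (Ab : DirBlockFamily d) (ι : Fin d × Bool) (a : Fin 3) : ℝ≥0∞ :=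
  ∑' x, ∑' u, ∑' w, wt x * (Sn a u w * Ab ι a 0 u w x x)

/-- **The `(ι,b)` piece of `R_L`** after the start collapse of `rawL_eq`:
`R_L(ι,b) := Σ_{x,t,z} ‖x‖₂² Ā^{ι,0,b}(0,0,t,z) · (P^E − u⃗)_b(t−x,z−x)` — start triangle trivial (`u = w = 0`),
exit triangle of class `b`, weight `‖x‖₂²` carried unsplit ("We bound the diagram in which u = w = 0 … in the same way").
[cite: FitznerVanDerHofstad2017, App. C.1 (arXiv:1506.07977v2 pp. 79–80; TeX AdditionalBoundForLongVersion.tex l.79)] -/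
def rawLPiece (Ab : DirBlockFamily d) (En : Fin 3 → Site d → Site d → ℝ≥0∞) (ι : Fin d × Bool) (b : Fin 3) : ℝ≥0∞ :=
  ∑' x, ∑' t, ∑' z, wt x * (Ab ι 0 b 0 0 t z * En b (t - x) (z - x))

/-- `R_R = Σ_{ι,a} R_R(ι,a)`. [cite: FitznerVanDerHofstad2017, App. C.1 (arXiv:1506.07977v2 p. 79; TeX AdditionalBoundForLongVersion.tex l.9–21)] -/
theorem rawR_eq_sum_rawRPiece (Sn : Fin 3 → Site d → Site d → ℝ≥0∞) (Ab : DirBlockFamily d) :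
    rawR Sn Ab = ∑ ι : Fin d × Bool, ∑ a : Fin 3, rawRPiece Sn Ab ι a := by
  rw [rawR_eq]
  simp only [rawRPiece, tsum_finsetSum]

/-- `R_L = Σ_{ι,b} R_L(ι,b)`. [cite: FitznerVanDerHofstad2017, App. C.1 (arXiv:1506.07977v2 pp. 79–80; TeX AdditionalBoundForLongVersion.tex l.79)] -/
theorem rawL_eq_sum_rawLPiece (Ab : DirBlockFamily d) (En : Fin 3 → Site d → Site d → ℝ≥0∞) :
    rawL Ab En = ∑ ι : Fin d × Bool, ∑ b : Fin 3, rawLPiece Ab En ι b := by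
  rw [rawL_eq]
  simp only [rawLPiece, tsum_finsetSum]

/-- **Case a), right side trivial — the convolution shape.** If the class-`0` start letter is a collapsed
double connection `(P^S − u⃗)_0(u,w) = δ_{u,w} F(u)` and `Ā^{ι,0,0}` is translation invariant, then
`R_R(ι,0) = Σ_w Σ_x ‖x‖₂² F(w) G(x − w)` with `G(s) := Ā^{ι,0,0}(0,0,s,s)` — the left side of the orthogonal split
`‖x‖₂² = ‖w‖₂² + ‖x−w‖₂² + 2⟨w, x−w⟩` of (C.2) (the cross term dies on the evenness of `F`; that step is the
parallelogram lemma, not taken here). [cite: FitznerVanDerHofstad2017, App. C.1 Case a), (C.2) (arXiv:1506.07977v2 p. 79; TeX AdditionalBoundForLongVersion.tex l.22–32)] -/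
theorem rawRPiece_zero_eq_of_kd (Sn : Fin 3 → Site d → Site d → ℝ≥0∞) (Ab : DirBlockFamily d) (ι : Fin d × Bool)
    (F : Site d → ℝ≥0∞) (hSn : ∀ u w, Sn 0 u w = kd u w * F u) (hAb : IsTransInv (Ab ι 0 0)) :
    rawRPiece Sn Ab ι 0 = ∑' w, ∑' x, wt x * F w * Ab ι 0 0 0 0 (x - w) (x - w) := by
  unfold rawRPiece
  have h1 : ∀ x u, ∑' w, wt x * (Sn 0 u w * Ab ι 0 0 u w x x) = wt x * F u * Ab ι 0 0 0 0 (x - u) (x - u) := by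
    intro x u
    rw [tsum_eq_single u (fun w hw => by rw [hSn, kd_of_ne (Ne.symm hw)]; simp)]
    have h2 : Ab ι 0 0 u u x x = Ab ι 0 0 0 0 (x - u) (x - u) := by
      have h := hAb (-u) u u x x
      simp only [add_neg_cancel, ← sub_eq_add_neg] at h
      exact h.symm
    rw [hSn, kd_self, one_mul, h2]
    exact (mul_assoc _ _ _).symm
  simp only [h1]
  exact ENNReal.tsum_comm

/-- **Left side trivial, exit class `0` — the convolution shape.** If the class-`0` exit letter is a collapsed
double connection `(P^E − u⃗)_0(s,s') = δ_{s,s'} F(s)`, then `R_L(ι,0) = Σ_t Σ_x ‖x‖₂² G(t) F(t − x)` with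
`G(t) := Ā^{ι,0,0}(0,0,t,t)` (no translation needed: the start is pinned at the origin).
[cite: FitznerVanDerHofstad2017, App. C.1 Case a) mirrored, "in the same way" (arXiv:1506.07977v2 pp. 79–80; TeX AdditionalBoundForLongVersion.tex l.22–32, l.79)] -/
theorem rawLPiece_zero_eq_of_kd (Ab : DirBlockFamily d) (En : Fin 3 → Site d → Site d → ℝ≥0∞) (ι : Fin d × Bool)
    (F : Site d → ℝ≥0∞) (hEn : ∀ s s', En 0 s s' = kd s s' * F s) :
    rawLPiece Ab En ι 0 = ∑' t, ∑' x, wt x * Ab ι 0 0 0 0 t t * F (t - x) := by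
  unfold rawLPiece
  have h1 : ∀ x t, ∑' z, wt x * (Ab ι 0 0 0 0 t z * En 0 (t - x) (z - x)) = wt x * Ab ι 0 0 0 0 t t * F (t - x) := by
    intro x t
    have hne : ∀ z, z ≠ t → t - x ≠ z - x := fun z hz h => hz.symm (sub_left_injective h)
    rw [tsum_eq_single t (fun z hz => by rw [hEn, kd_of_ne (hne z hz)]; simp)]
    rw [hEn, kd_self, one_mul]
    exact (mul_assoc _ _ _).symm
  simp only [h1]
  exact ENNReal.tsum_comm

/-- Case a) for the NoBLE letters: `R_R(ι,0) = Σ_w Σ_x ‖x‖₂² (1−δ_{0,w}) P(0⇔w) · Ā^{ι,0,0}(0,0,x−w,x−w)` for any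
`Letters d` and any translation-invariant `Ā^{ι,0,0}`. [cite: FitznerVanDerHofstad2017, App. C.1 Case a), (C.2) (arXiv:1506.07977v2 p. 79; TeX AdditionalBoundForLongVersion.tex l.22–32)] -/
theorem rawRPiece_blockPSn_zero_eq (L : Letters d) (Ab : DirBlockFamily d) (ι : Fin d × Bool) (hAb : IsTransInv (Ab ι 0 0)) :
    rawRPiece (blockPSn L) Ab ι 0 = ∑' w, ∑' x, wt x * (kdc w 0 * L.dbc w) * Ab ι 0 0 0 0 (x - w) (x - w) :=
  rawRPiece_zero_eq_of_kd _ Ab ι (fun u => kdc u 0 * L.dbc u) (blockPSn_zero_eq L) hAb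

/-- Left-trivial, exit class `0`, for the NoBLE letters: `R_L(ι,0) = Σ_t Σ_x ‖x‖₂² Ā^{ι,0,0}(0,0,t,t) · (1−δ_{0,t−x}) P(0⇔t−x)`.
[cite: FitznerVanDerHofstad2017, App. C.1 Case a) mirrored (arXiv:1506.07977v2 pp. 79–80; TeX AdditionalBoundForLongVersion.tex l.22–32, l.79)] -/
theorem rawLPiece_blockPEn_zero_eq (L : Letters d) (Ab : DirBlockFamily d) (ι : Fin d × Bool) :
    rawLPiece Ab (blockPEn L) ι 0 = ∑' t, ∑' x, wt x * Ab ι 0 0 0 0 t t * (kdc (t - x) 0 * L.dbc (t - x)) :=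
  rawLPiece_zero_eq_of_kd Ab _ ι (fun s => kdc s 0 * L.dbc s) (blockPEn_zero_eq L)

/-- The `w = 0` part of `R_R(ι,a)` (Case b): "a = 1, 2 and w = 0", the rows `δ_{0,y} B_{3,1̲}(x,0)`, `δ_{0,y} D_{2,2}(x)`
of `P^{S,1}`, `P^{S,2}`). [cite: FitznerVanDerHofstad2017, App. C.1 Case b), (C.3) (arXiv:1506.07977v2 p. 79; TeX AdditionalBoundForLongVersion.tex l.34–40)] -/
def rawRPieceAt0 (Sn : Fin 3 → Site d → Site d → ℝ≥0∞) (Ab : DirBlockFamily d) (ι : Fin d × Bool) (a : Fin 3) : ℝ≥0∞ :=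
  ∑' x, ∑' u, wt x * (Sn a u 0 * Ab ι a 0 u 0 x x)

/-- The `w ≠ 0` part of `R_R(ι,a)` (Cases c), d): "a = 1, 2 and w ≠ 0"). [cite: FitznerVanDerHofstad2017, App. C.1 Cases c), d), (C.4)–(C.5) (arXiv:1506.07977v2 p. 79; TeX AdditionalBoundForLongVersion.tex l.41–77)] -/
def rawRPieceOff0 (Sn : Fin 3 → Site d → Site d → ℝ≥0∞) (Ab : DirBlockFamily d) (ι : Fin d × Bool) (a : Fin 3) : ℝ≥0∞ :=
  ∑' x, ∑' u, ∑' w, wt x * (kdc w 0 * (Sn a u w * Ab ι a 0 u w x x))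

/-- `R_R(ι,a) = [w = 0 part] + [w ≠ 0 part]` (`1 = δ_{w,0} + (1 − δ_{w,0})`). [cite: FitznerVanDerHofstad2017, App. C.1 "we consider four different cases for the left triangle" (arXiv:1506.07977v2 p. 79; TeX AdditionalBoundForLongVersion.tex l.9–21)] -/
theorem rawRPiece_eq_at0_add_off0 (Sn : Fin 3 → Site d → Site d → ℝ≥0∞) (Ab : DirBlockFamily d) (ι : Fin d × Bool) (a : Fin 3) :
    rawRPiece Sn Ab ι a = rawRPieceAt0 Sn Ab ι a + rawRPieceOff0 Sn Ab ι a := by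
  unfold rawRPiece rawRPieceAt0 rawRPieceOff0
  rw [← ENNReal.tsum_add]
  refine tsum_congr fun x => ?_
  rw [← ENNReal.tsum_add]
  refine tsum_congr fun u => ?_
  have hsplit : ∀ w, wt x * (Sn a u w * Ab ι a 0 u w x x)
      = kd w 0 * (wt x * (Sn a u w * Ab ι a 0 u w x x)) + wt x * (kdc w 0 * (Sn a u w * Ab ι a 0 u w x x)) := by
    intro w
    rw [← mul_assoc (wt x) (kdc w 0), mul_comm (wt x) (kdc w 0), mul_assoc (kdc w 0), ← add_mul, kd_add_kdc, one_mul]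
  rw [tsum_congr hsplit, ENNReal.tsum_add, tsum_eq_single (0 : Site d) (fun w hw => by rw [kd_of_ne hw, zero_mul])]
  rw [kd_self, one_mul]

/-- The sum of the VERSION-2 raw integrand splits into its six pieces. [cite: FitznerVanDerHofstad2017, Lemma 5.1 second version (arXiv:1506.07977v2 p. 50); App. C.1 (arXiv:1506.07977v2 p. 79)] -/
theorem tsum_v2Integrand_eq (PSn QS PEn QE : Fin 3 → Site d → Site d → ℝ≥0∞) (Ab Am : DirBlockFamily d) :
    ∑' x, ∑' u, ∑' w, ∑' t, ∑' z, ∑ ι : Fin d × Bool, ∑ a : Fin 3, ∑ b : Fin 3,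
        v2Integrand PSn QS PEn QE Ab Am x ι a b u w t z =
      blkTsum blockTriv (wtMid Ab) blockTriv + rawR PSn Ab + rawL Ab PEn
        + 3 * blkTsum (wtSnd QS) (revT Am) PEn + 3 * blkTsum PSn (wtMid Ab) PEn + 3 * blkTsum PSn Am (wtSnd QE) := by
  simp only [blkTsum, rawR, rawL, v2Integrand, ENNReal.tsum_add, Finset.sum_add_distrib, ENNReal.tsum_mul_left,
    ← Finset.mul_sum]

/-- From the six pieces to `versionTwoRaw` (monotonicity bookkeeping). [folklore] -/
private theorem six_le_versionTwoRaw {S₁ S₄ S₅ S₆ RR RL : ℝ≥0∞} {u sn en hS hE : Fin 3 → ℝ≥0∞}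
    {H A AT : Matrix (Fin 3) (Fin 3) ℝ≥0∞} (h₁ : S₁ ≤ u ᵥ* H ⬝ᵥ u) (h₄ : S₄ ≤ hS ᵥ* AT ⬝ᵥ en)
    (h₅ : S₅ ≤ sn ᵥ* H ⬝ᵥ en) (h₆ : S₆ ≤ sn ᵥ* A ⬝ᵥ hE) :
    S₁ + RR + RL + 3 * S₄ + 3 * S₅ + 3 * S₆ ≤ versionTwoRaw u sn en hS hE H A AT RR RL := by
  unfold versionTwoRaw
  gcongr

/-- **[FvdH17] Lemma 5.1, VERSION 2 in raw form, with the averaged `Ā`-element — PROVED bookkeeping.**  If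
`‖x‖₂² Ξ(x) ≤ Σ V₂^{raw}(x;…)` for every `x` (part D″), then
`Σ_x ‖x‖₂² Ξ(x) ≤ versionTwoRaw u⃗ (P⃗^S−u⃗) (P⃗^E−u⃗) h⃗^S h⃗^E H A Aᵀ R_R R_L` with `H = matAbarAvg U avg (wtMid Ā)`,
`A = matB A^ι`, `Aᵀ = (matB A^ι)ᵀ`, flanks `vecH (wtSnd Q)`, and the two one-side-trivial sums `rawR P^S_n Ā`,
`rawL Ā P^E_n` carried RAW (to be bounded by App. C.1).  Hypotheses as `tsum_wt_mul_le_versionOne_avg`.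
[cite: FitznerVanDerHofstad2017, Lemma 5.1 (lemmapercboundXi1-2) second version (arXiv:1506.07977v2 p. 50; TeX `Bounds/BoundNOne.tex` l.19–30); §6.1 (pp. 58–60); App. C.1 (arXiv:1506.07977v2 p. 79)] -/
theorem tsum_wt_mul_le_versionTwoRaw_avg (U : Finset (Site d)) (h0 : (0 : Site d) ∉ U) (avg : Fin 3 → Bool)
    (Ξ : Site d → ℝ≥0∞) (PS PSn QS PE PEn QE : Fin 3 → Site d → Site d → ℝ≥0∞) {Ab Am : DirBlockFamily d}
    (hAb : ∀ ι a b, IsTransInv (Ab ι a b)) (hAm : ∀ ι a b, IsTransInv (Am ι a b))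
    (hAin : ∀ ι a b, avg a = true → ∀ v x y, v ∉ U → Ab ι a b 0 v x y = 0)
    (hAout : ∀ ι a b, avg b = true → ∀ v x y, y - x ∉ U → Ab ι a b 0 v x y = 0)
    (hPS : ∀ a x y, PS a x y = blockTriv a x y + PSn a x y) (hPE : ∀ b x y, PE b x y = blockTriv b x y + PEn b x y)
    (hS : ∀ a, avg a = true → IsConstOn U (gapSum (PS a))) (hE : ∀ b, avg b = true → IsConstOn U (gapSum (PE b)))
    (hΞ : ∀ x, wt x * Ξ x ≤ ∑' u, ∑' w, ∑' t, ∑' z, ∑ ι : Fin d × Bool, ∑ a : Fin 3, ∑ b : Fin 3,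
      v2Integrand PSn QS PEn QE Ab Am x ι a b u w t z) :
    ∑' x, wt x * Ξ x ≤ versionTwoRaw (vecP (blockTriv (d := d))) (vecP PSn) (vecP PEn) (vecH (wtSnd QS))
      (vecH (wtSnd QE)) (matAbarAvg U avg (wtMid Ab)) (matB Am) (matB Am)ᵀ (rawR PSn Ab) (rawL Ab PEn) := by
  have hH : ∀ ι a b, IsTransInv (wtMid Ab ι a b) := isTransInv_wtMid hAb
  have hHin : ∀ ι a b, avg a = true → ∀ v x y, v ∉ U → wtMid Ab ι a b 0 v x y = 0 :=
    fun ι a b ha v x y hv => wtMid_eq_zero_of (hAin ι a b ha v x y hv)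
  have hHout : ∀ ι a b, avg b = true → ∀ v x y, y - x ∉ U → wtMid Ab ι a b 0 v x y = 0 :=
    fun ι a b hb v x y hxy => wtMid_eq_zero_of (hAout ι a b hb v x y hxy)
  have hTr : ∀ a, avg a = true → IsConstOn U (gapSum (blockTriv (d := d) a)) := fun a _ => isConstOn_gapSum_blockTriv h0 a
  have hSn : ∀ a, avg a = true → IsConstOn U (gapSum (PSn a)) :=
    fun a ha => isConstOn_gapSum_of_eq_blockTriv_add h0 (hPS a) (hS a ha)
  have hEn : ∀ b, avg b = true → IsConstOn U (gapSum (PEn b)) :=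
    fun b hb => isConstOn_gapSum_of_eq_blockTriv_add h0 (hPE b) (hE b hb)
  calc ∑' x, wt x * Ξ x
      ≤ ∑' x, ∑' u, ∑' w, ∑' t, ∑' z, ∑ ι : Fin d × Bool, ∑ a : Fin 3, ∑ b : Fin 3,
          v2Integrand PSn QS PEn QE Ab Am x ι a b u w t z := ENNReal.tsum_le_tsum hΞ
    _ = _ := tsum_v2Integrand_eq PSn QS PEn QE Ab Am
    _ ≤ _ := six_le_versionTwoRaw (blkTsum_le_vecP_matAbarAvg_vecP U avg hH hHin hHout _ _ hTr hTr)
        (blkTsum_revT_le_vecH_matBT_vecP hAm _ _)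
        (blkTsum_le_vecP_matAbarAvg_vecP U avg hH hHin hHout _ _ hSn hEn) (blkTsum_le_vecP_matB_vecH hAm _ _)

/-! ## F. The percolation letters: what the consumer of (lemmapercboundXi1-2) reads off -/

namespace NobleBlocks

/-- `(u⃗ ᵥ* M ⬝ᵥ w)` with `u⃗ = (1,0,0)` is the row-`0` form `Σ_b M_{0,b} w_b`. (matrix algebra with `u⃗`). [cite: FitznerVanDerHofstad2017, Lemma 5.1 (5.3), the vector `u⃗ = (1,0,0)` (arXiv:1506.07977v2 p. 48); App. C.1 (C.1) (p. 79)] -/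
theorem vecP_blockTriv_vecMul_dotProduct (M : Matrix (Fin 3) (Fin 3) ℝ≥0∞) (w : Fin 3 → ℝ≥0∞) :
    vecP (blockTriv (d := d)) ᵥ* M ⬝ᵥ w = ∑ b, M 0 b * w b := by
  simp only [Matrix.vecMul, dotProduct, vecP_blockTriv, Fin.sum_univ_three]
  simp

/-- `(v ᵥ* M ⬝ᵥ u⃗)` with `u⃗ = (1,0,0)` is the column-`0` form `Σ_a v_a M_{a,0}`. (matrix algebra with `u⃗`). [cite: FitznerVanDerHofstad2017, Lemma 5.1 (5.3), the vector `u⃗ = (1,0,0)` (arXiv:1506.07977v2 p. 48); App. C.1 (C.1) (p. 79)] -/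
theorem vecMul_dotProduct_vecP_blockTriv (M : Matrix (Fin 3) (Fin 3) ℝ≥0∞) (v : Fin 3 → ℝ≥0∞) :
    v ᵥ* M ⬝ᵥ vecP (blockTriv (d := d)) = ∑ a, v a * M a 0 := by
  simp only [Matrix.vecMul, dotProduct, vecP_blockTriv, Fin.sum_univ_three]
  simp

/-- `P⃗^S = u⃗ + (P⃗^S − u⃗)` for the percolation letters (componentwise, no truncated subtraction).
[cite: FitznerVanDerHofstad2017, §6.1 (XiIota-Deltabounds-versions1) (arXiv:1506.07977v2 p. 60)] -/
theorem vecPS_eq_vecP_blockTriv_add (L : Letters d) (a : Fin 3) :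
    vecPS L a = vecP (blockTriv (d := d)) a + vecP (blockPSn L) a := by
  unfold vecPS vecP pairSum
  rw [← ENNReal.tsum_add]
  refine tsum_congr fun x => ?_
  rw [← ENNReal.tsum_add]
  exact tsum_congr fun y => blockPS_eq_blockTriv_add_blockPSn L a x y

/-- `P⃗^E = u⃗ + (P⃗^E − u⃗)` for the percolation letters. [cite: FitznerVanDerHofstad2017, §6.1 (XiIota-Deltabounds-versions1) (arXiv:1506.07977v2 p. 60)] -/
theorem vecPE_eq_vecP_blockTriv_add (L : Letters d) (b : Fin 3) :
    vecPE L b = vecP (blockTriv (d := d)) b + vecP (blockPEn L) b := by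
  unfold vecPE vecP pairSum
  rw [← ENNReal.tsum_add]
  refine tsum_congr fun x => ?_
  rw [← ENNReal.tsum_add]
  exact tsum_congr fun y => blockPE_eq_blockTriv_add_blockPEn L b x y

end NobleBlocks

/-! ## G. Monotonicity of the elements in the block (for the identification `Ā' ≤ Ā'^*` of the `H`-matrix) -/

/-- `normOO` is monotone in the block. (monotonicity of the element in the block). [cite: FitznerVanDerHofstad2017, §6.1 (6.5) and Lemma 5.3 — the `x`-space → matrix-element transfer `Σ ≤ sup` (arXiv:1506.07977v2 pp. 49, 60)] -/
theorem normOO_mono {M M' : Site d → Site d → Site d → Site d → ℝ≥0∞} (h : ∀ u v x y, M u v x y ≤ M' u v x y) :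
    normOO M ≤ normOO M' :=
  iSup_mono fun v => iSup_mono fun y => ENNReal.tsum_le_tsum fun x => h 0 v x (x + y)

/-- `openGap` is monotone in the block. (monotonicity of the element in the block). [cite: FitznerVanDerHofstad2017, §6.1 (6.5) and Lemma 5.3 — the `x`-space → matrix-element transfer `Σ ≤ sup` (arXiv:1506.07977v2 pp. 49, 60)] -/
theorem openGap_mono {M M' : Site d → Site d → Site d → Site d → ℝ≥0∞} (h : ∀ u v x y, M u v x y ≤ M' u v x y)
    (v y : Site d) : openGap M v y ≤ openGap M' v y :=
  ENNReal.tsum_le_tsum fun s => h 0 v s (s + y)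

/-- The class-averaged double-open element is monotone in the block (all four shapes). (monotonicity of the element in the block). [cite: FitznerVanDerHofstad2017, §6.1 (6.5) and Lemma 5.3 — the `x`-space → matrix-element transfer `Σ ≤ sup` (arXiv:1506.07977v2 pp. 49, 60)] -/
theorem normOOavg_mono (U : Finset (Site d)) (bi bo : Bool) {M M' : Site d → Site d → Site d → Site d → ℝ≥0∞}
    (h : ∀ u v x y, M u v x y ≤ M' u v x y) : normOOavg U bi bo M ≤ normOOavg U bi bo M' := by
  cases bi <;> cases bo
  · simpa only [normOOavg_false_false] using normOO_mono h
  · rw [normOOavg_false_true, normOOavg_false_true]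
    exact iSup_mono fun v => avgOn_mono U fun y _ => openGap_mono h v y
  · rw [normOOavg_true_false, normOOavg_true_false]
    exact iSup_mono fun y => avgOn_mono U fun v _ => openGap_mono h v y
  · rw [normOOavg_true_true, normOOavg_true_true]
    exact avgOn_mono U fun v _ => avgOn_mono U fun y _ => openGap_mono h v y

/-- `matAbarAvg` is entrywise monotone in the family, entry by entry. (monotonicity of the element in the block). [cite: FitznerVanDerHofstad2017, §6.1 (6.5) and Lemma 5.3 — the `x`-space → matrix-element transfer `Σ ≤ sup` (arXiv:1506.07977v2 pp. 49, 60)] -/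
theorem matAbarAvg_apply_mono (U : Finset (Site d)) (avg : Fin 3 → Bool) {A A' : DirBlockFamily d} {a b : Fin 3}
    (h : ∀ ι u v x y, A ι a b u v x y ≤ A' ι a b u v x y) : matAbarAvg U avg A a b ≤ matAbarAvg U avg A' a b := by
  rw [matAbarAvg_apply, matAbarAvg_apply]
  exact normOOavg_mono U _ _ fun u v x y => Finset.sum_le_sum fun ι _ => h ι u v x y

/-- Entry `(a,b)` of `matAbarAvg` depends only on the blocks `A ι a b`. (the entry depends only on its own blocks). [cite: FitznerVanDerHofstad2017, §6.1 (6.5) and Lemma 5.3 — the `x`-space → matrix-element transfer `Σ ≤ sup` (arXiv:1506.07977v2 pp. 49, 60)] -/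
theorem matAbarAvg_apply_congr (U : Finset (Site d)) (avg : Fin 3 → Bool) {A A' : DirBlockFamily d} {a b : Fin 3}
    (h : ∀ ι, A ι a b = A' ι a b) : matAbarAvg U avg A a b = matAbarAvg U avg A' a b := by
  rw [matAbarAvg_apply, matAbarAvg_apply]
  simp only [h]

/-- `wtMid` is monotone in the family. (pointwise property of the weighting `‖x−y‖₂² Ā`). [cite: FitznerVanDerHofstad2017, App. B "Building blocks with weight", H^{(3)} (arXiv:1506.07977v2 p. 78); §6.1 (lemmapercboundXi1-1-step0.2) (p. 59)] -/
theorem wtMid_mono {A A' : DirBlockFamily d} {ι : Fin d × Bool} {a b : Fin 3}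
    (h : ∀ u v x y, A ι a b u v x y ≤ A' ι a b u v x y) (u v x y : Site d) :
    wtMid A ι a b u v x y ≤ wtMid A' ι a b u v x y :=
  mul_le_mul' le_rfl (h u v x y)

/-- `wtMid` commutes with replacing one block: `wtMid A ι a b = wtMid A' ι a b` if `A ι a b = A' ι a b`. (pointwise property of the weighting `‖x−y‖₂² Ā`). [cite: FitznerVanDerHofstad2017, App. B "Building blocks with weight", H^{(3)} (arXiv:1506.07977v2 p. 78); §6.1 (lemmapercboundXi1-1-step0.2) (p. 59)] -/
theorem wtMid_congr {A A' : DirBlockFamily d} {ι : Fin d × Bool} {a b : Fin 3} (h : A ι a b = A' ι a b) :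
    wtMid A ι a b = wtMid A' ι a b := by
  funext u v x y; simp only [wtMid, h]

end Literature.Probability.FitznerVanDerHofstad2017
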